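import Summits.QuantumFields.YangMills.Theorems.BalabanLadderIRColdDoublingRecursionSC
import Summits.QuantumFields.YangMills.Theorems.EquipartitionCriticalityFreeEnergyLogCoefficient
import Literature.MathematicalPhysics.QuantumLattice.LatticeGaugeDLRFreeEnergyProofs
import Literature.MathematicalPhysics.QuantumFieldTheory.ChatterjeeScaleComparison
import HarnessLib
import Literature.MathematicalPhysics.QuantumFieldTheory.LatticeRPCauchySchwarz
import Literature.MathematicalPhysics.QuantumFieldTheory.ConstructiveQFTWave0Proofs
import Literature.RepresentationTheory.CompactGroups.UnitaryTrick
import Literature.MathematicalPhysics.QuantumFieldTheory.LatticeGaugeProofs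
import Literature.MathematicalPhysics.QuantumFieldTheory.TorusFreeTransfer

/-!
# Cruxes/IR — line `pressure-monotone-tm` (ideator `ym-ir-idea-5` g7, lens: chessboard / RP transfer-matrix bounds)

SUPPLIER, PROVED (`lean check` rc 0, no `sorry`; the `def`s are bookkeeping `Prop`s — a verbatim mirror of idea-4's
`FreeEnergyIncrementFrom`, the classical multiple-reflection bound `FreeCubeRPDoubling[All]` of §5 (Glimm–Jaffe
Prop. 10.5.1 for the product Haar measure — typed in §5 and PROVED in Part B / §6 of this v3, so that every
statement below is now UNCONDITIONAL) — and the floor functions `linFloor`, `logFloor`, `iterSide`):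
**the torus pressure of Wilson's lattice gauge theory is non-increasing in the period, in every axis, with
no error term**, hence **the finite torus free energy is bounded BELOW by the infinite-volume free energy
density times the volume, for EVERY side `L ≥ 2` and every `β ≥ 0`**; and (§4) **a ceiling with cost on the
BOUNDARY only, `log Z_{Λ_L,β} ≤ L⁴ f(β) + C_r β L³`, whence the free-energy increment (FE) of the large-field
rarity engine above the LINEAR volume floor `L ≥ ⌈β⌉₊ + 2`** (idea-4 g3: quadratic floor `(⌈β⌉₊+2)²`):

* `slot3_mul_log_le` … `slot2_mul_log_le` (abstract, §1): for an axis-symmetric family `Z : ℕ⁴ → ℝ` that is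
  trace-positive in the last slot for every spatial box, `n · log Z(…, n', …) ≤ n' · log Z(…, n, …)` in each of
  the four slots, `2 ≤ n ≤ n'` — the `ℓᵖ`-monotonicity `‖λ‖_{n'} ≤ ‖λ‖_{n}` of the (non-negative, Lüscher)
  transfer-matrix spectrum (tree `AspectBootstrap.mul_log_le`), transported to every axis by the three
  transpositions of `IsAxisSymmetric`;
* `cube_mul_log_le`: `L⁴ · log Z(L',L',L',L') ≤ L'⁴ · log Z(L,L,L,L)` for `2 ≤ L ≤ L'`;
  `box_mul_log_le`: `n₀n₁n₂n₃ · log Z(M,M,M,M) ≤ M⁴ · log Z(n₀,n₁,n₂,n₃)` for `2 ≤ nᵢ ≤ M`;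
* (§2, Wilson's model, every compact `G`, every lattice representation `r`, `β ≥ 0`)
  `torusPressure_antitone`: `L ↦ L⁻⁴ log Z_{Λ_L,β}` is non-increasing on `L ≥ 2`;
  `volume_mul_le_torusLogPartition` / `volume_mul_freeEnergyDensity_le_torusLogPartition`:
  **`L⁴ · f(β) ≤ log Z_{Λ_L,β}` for all `L ≥ 2`** (`f` = the tree's `freeEnergyDensity 4 r.ρ β`, which exists by
  `exists_hasFreeEnergyDensity_holds`); the anisotropic form `boxVolume_mul_freeEnergyDensity_le_log`:
  `n₀n₁n₂n₃ · f(β) ≤ log Z_{r,β}(n₀,n₁,n₂,n₃)` (all sides `≥ 2`); and the spectral form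
  `spatialVolume_mul_freeEnergyDensity_le_phi`: `b₁b₂b₃ · f(β) ≤ φ(b₁,b₂,b₃) = log λ₀` — the ground-state energy
  per site of the spatial torus `b₁ × b₂ × b₃` is at most `−f(β)`;
* (§3, consequences for the `BalabanLadder.IR` bookkeeping) `uniform_floor_of_tendsto`: any asymptotic
  `f(β) + c log β → K` (Chatterjee: `c = 3N²/2` for `U(N)`, tree `SoloBlind.tendsto_freeEnergyDensity_add_log`;
  `c = 3 dim G/2` expected in general) yields the **β-UNIFORM SHARP FLOOR `log Z_{Λ_L,β} ≥ L⁴ (K − ε − c log β)`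
  for ALL `L ≥ 2` and all `β ≥ β_ε`, with NO volume floor** — replacing the crude link-ball floors of the tree
  (`torusLogPartition_lower_rep`: coefficient `2·dimE·L⁴` of `log β`, constant `−48L⁴`) by the sharp Gaussian
  coefficient; `increment_le_excess_add`: the free-energy increment of the large-field rarity engine satisfies
  `log Z_L(β') − log Z_L(β) ≤ [log Z_L(β') − L⁴ f(β')] + L⁴ (f(β') − f(β))` for all `L ≥ 2` — the FLOOR half of the
  finite-size sandwich `FiniteSizeFreeEnergy` of `Lines/largefield_rarity_chessboard.lean` (idea-4 g3) and of
  `Lines/largefield_rarity_uniform.lean` (this seat, g6) is now exact and β-free; only the CEILING half carries a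
  volume floor;
* (§4, the ceiling and the LINEAR floor) `torusLogPartition_le_freeBox`: `log Z_{Λ_{n+1},β} ≤ (n+1)⁴ f(β) +
  10·β(N+M)·#planes·(n+1)³` (one free cube inside the torus: the tree's sub-box estimate at `q = 1`, subset
  monotonicity of the Boltzmann weight at `β ≥ 0`, Chatterjee's Lemma 17.5 `ChatterjeeFreeEnergy.le_freeEnergyDensity`);
  `finiteSize_linear`: `L⁴ f(β) ≤ log Z_{Λ_L,β} ≤ L⁴ f(β) + C_r β L³` for all `β ≥ 0`, `L ≥ 2`;
  `increment_bound_of_tendsto`: from ANY asymptotic `f(β) + c log β → K`, `log Z_L(β') − log Z_L(β) ≤ c L⁴ log(β/β') +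
  C L⁴` for `β₃ ≤ β' ≤ β` and `L ≥ linFloor β = ⌈β⌉₊ + 2`; `freeEnergyIncrementFrom_linFloor :
  FreeEnergyIncrementFrom linFloor` — idea-4's (FE) `Prop` (mirrored verbatim) PROVED above the linear floor for every
  compact simple `G` (tree `freeEnergyLogCoefficient_proof`).  Fed to idea-4's proved floor-parametric engine
  `largeFieldRarityOn_of_ZRatio chessboardZRatio_odd : FreeEnergyIncrementFrom fl → LargeFieldRarityOnFrom {odd ≥ 3} fl`
  it yields β-uniform Peierls-multiplicative large-field rarity on all odd tori `2S+1 ≥ ⌈β⌉₊ + 2`; the residual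
  `LargeFieldRaritySmallTori` shrinks from `2S+1 < (⌈β⌉₊+2)²` to `2S+1 ≤ ⌈β⌉₊ + 1`;
* (§5, the LOGARITHMIC floor by MULTIPLE REFLECTIONS — Glimm–Jaffe §10.5 transplanted to the free Wilson cubes)
  `FreeCubeRPDoubling ρ β` (typed): `Z(B_m)^{16} ≤ Z(B_{2m−1})`, `m ≥ 1` (site-reflection positivity of the product Haar
  measure, four Schwarz inequalities = GJ Prop. 10.5.1 with `k` = the half-face-weighted cube weight);
  PROVED from it: `log_freeCube_le_of_doubling`: `log Z(B_m) ≤ (m−1)⁴ f(β)` (NO β-cost; exact in `d = 2`);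
  `torusLogPartition_le_log_freeCube` (unconditional, one-sided periodisation at no cost): `log Z_{Λ_{n+2},β} ≤ log Z(B_{n+1})`;
  `torusLogPartition_le_of_doubling`: `log Z_{Λ_L,β} ≤ (L−2)⁴ f(β)`; `increment_bound_log_of_tendsto` and
  `freeEnergyIncrementFrom_logFloor : FreeCubeRPDoublingAll → FreeEnergyIncrementFrom logFloor`, `logFloor β = ⌈log β⌉₊ + 2`:
  (FE), hence idea-4's β-uniform rarity, on all odd tori `2S+1 ≥ ⌈log β⌉₊ + 2` — the residual shrinks to `2S+1 ≤ ⌈log β⌉₊+1`,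
  i.e. `L⁴ ≲ (log β)⁴`, next to the toron regime `L⁴ ≲ log β` where the β-uniform ceiling is false;
* (Part B = `Lines/rp_doubling.lean` verbatim, namespace `…Cruxes.IR.RPDoubling`, §B1–§B5; duplicated here only because
  Cruxes workfiles cannot import one another on the farm — land it as its own module and replace Part B by an `import`)
  **reflection positivity of the product Haar measure in lattice HYPERPLANES THROUGH SITES** (`x_i = c` on the torus
  `(ℤ/L)^d`, `Θ` inverting the links of direction `i`; `measurePreserving_configReflect`, the Schwarz inequality
  `sq_integral_prod_tw_le : (∫ ∏_{p∈A} e^{−βS_p})² ≤ ∫ ∏_{p ∈ A ∪ θ(A∖faces)} e^{−βS_p}` for upper plaquette sets `A` of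
  range `2H < L`, via the tree's abstract site-RP Cauchy–Schwarz `LatticeRP.re_sum_pair_sq_le` with half weights
  `e^{−βS_p/2}` on the face plaquettes), its transfer to `ℤ^d` (`zdZ_sq_le_zdZ_zDouble`, through
  `FreeEnergy.integral_torusWeight_image`), the box combinatorics `zDouble_boxPlaqs` (a box reflected in its bottom face is
  the doubled box) and `d` successive reflections `zdZ_boxPlaqs_pow_le`, whence **`zdZ_cubePlaqs_pow_le :
  Z([0,m)^d)^(2^d) ≤ Z([0,2m−1)^d)`** for every `d`, every compact `G`, every continuous `ρ` with `Re tr ρ ≤ N`, every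
  `β ≥ 0`, `m ≥ 1`, and `zdPartitionFunction_halfOpenBox_pow_sixteen_le` (`d = 4`);
* (§6) `freeCubeRPDoublingAll_holds : FreeCubeRPDoublingAll` and **`freeEnergyIncrementFrom_logFloor_holds :
  FreeEnergyIncrementFrom logFloor` — (FE) above the LOGARITHMIC volume floor `⌈log β⌉₊ + 2`, unconditionally.**

WHY THIS IS THE LENS: reflection positivity in all four axes (Osterwalder–Seiler) = a positive self-adjoint
Hilbert–Schmidt transfer matrix in every direction (tree `exists_spectralData_wilsonFinTorusPartition_box`,
`posType_finTorusSliceKernel`); `Z = Tr 𝕋ⁿ = Σ λᵢⁿ` with `λᵢ ≥ 0` makes `(log Z(n))/n = log ‖λ‖ₙ` non-increasing in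
`n`.  Nothing model-specific enters: the floor holds for `U(1)` as well (it carries NO Yang–Mills difficulty).

WHAT IT DOES NOT DO (honesty clause).  Nothing here proves the Yang–Mills mass gap (Clay), `BalabanLadder.IR`
(item 19354), a lattice gap, or `BalabanLadder.NT`; `R4` closes only the conditional finite-`𝕋⁴` rung
`BalabanLadder.UV`.  The proved ceiling costs `β` per boundary plaquette (`C_r β L³`), which is why the floor is linear; the
β-UNIFORM ceiling `log Z_{Λ_L,β} ≤ L⁴ f(β) + C·L⁴` below that floor is NOT proved and is in fact expected to be FALSE on
tori with `L⁴ ≪ log β`: the flat connections (torons; commuting quadruples in a maximal torus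
of `G`, `3·rank G` extra flat directions modulo gauge) give `log Z_{Λ_L,β} − L⁴ f(β) ≳ (3 rank G/2)·log β − C_L → ∞`
at fixed `L`.  So the floor-free residual `stub_largeFieldRaritySmallTori` of `Lines/smallfield_polymer_coder.lean`
must keep the DIFFERENCE form `[log Z_L(β') − L⁴f(β')] − [log Z_L(β) − L⁴f(β)] ≤ C L⁴` (excess increment), in which
the toron logarithms cancel; this file discharges every FLOOR that bookkeeping needs, the ceiling down to `L ≈ β`, and
isolates the excess increment on the tori `2 ≤ L ≤ ⌈β⌉₊ + 1` as the one remaining finite-size input (a Gaussian-accuracy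
gluing — interface cost `O(log β)` instead of `O(β)` per boundary plaquette — would lower the floor to `L ≈ log β`; below
`L⁴ ≈ log β` only a torus-intrinsic toron analysis can decide it).  See the card `Lines/pressure-monotone-tm.md`.

References: M. Lüscher, Commun. Math. Phys. 54 (1977) 283 (positivity of the transfer matrix); K. Osterwalder,
E. Seiler, Ann. Phys. 110 (1978) 440 (reflection positivity in all axes); I. Montvay, G. Münster, *Quantum Fields on
a Lattice* (1994) §3.2.6 (3.145) (`Z = Tr 𝕋ᴺ`); S. Chatterjee, arXiv:1602.01222, Thm. 2.1 (leading term of `f`);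
S. Friedli, Y. Velenik (2017) Thm. 3.6 (existence of the pressure).
-/

noncomputable section

open scoped Topology
open Filter MeasureTheory
open Literature.MathematicalPhysics.QuantumFieldTheory Literature.MathematicalPhysics.QuantumLattice
open Summit.QuantumFields.YangMills.Cruxes.IR.AspectBootstrap (HasSpectralDatum IsAxisSymmetric mul_log_le phi
  phi_ge_of_lower axisSymmetric)

namespace Summit.QuantumFields.YangMills.Cruxes.IR.PressureMonotoneTM

/-! ## §1 Abstract: slot-wise period monotonicity for axis-symmetric trace-positive families -/

section Abstract

variable {Z : ℕ → ℕ → ℕ → ℕ → ℝ}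

/-- [TM, all boxes] trace positivity in the last slot for EVERY spatial box (no side restriction; this is what the
tree's anisotropic trace formula actually gives for Wilson's action, cf. `AspectBootstrap.tracePositive`). -/
def IsTracePositiveAll (Z : ℕ → ℕ → ℕ → ℕ → ℝ) : Prop :=
  ∀ b₁ b₂ b₃ : ℕ, HasSpectralDatum (Z b₁ b₂ b₃)

/-- slot 3: `n · log Z(b₁,b₂,b₃,n') ≤ n' · log Z(b₁,b₂,b₃,n)` for `2 ≤ n ≤ n'` (`‖λ‖_{n'} ≤ ‖λ‖ₙ`). -/
theorem slot3_mul_log_le (hT : IsTracePositiveAll Z) (b₁ b₂ b₃ : ℕ) {n n' : ℕ} (hn : 2 ≤ n)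
    (hnn' : n ≤ n') : (n : ℝ) * Real.log (Z b₁ b₂ b₃ n') ≤ (n' : ℝ) * Real.log (Z b₁ b₂ b₃ n) := by
  obtain ⟨a, rfl⟩ : ∃ a, n = a + 2 := ⟨n - 2, by omega⟩
  obtain ⟨a', rfl⟩ : ∃ a', n' = a' + 2 := ⟨n' - 2, by omega⟩
  exact mul_log_le (hT b₁ b₂ b₃) (show a ≤ a' by omega)

/-- slot 0 (transposition `(0 3)`): `n · log Z(n',b,c,d) ≤ n' · log Z(n,b,c,d)` for `2 ≤ n ≤ n'`. -/
theorem slot0_mul_log_le (hS : IsAxisSymmetric Z) (hT : IsTracePositiveAll Z) (b c d : ℕ) {n n' : ℕ}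
    (hn : 2 ≤ n) (hnn' : n ≤ n') : (n : ℝ) * Real.log (Z n' b c d) ≤ (n' : ℝ) * Real.log (Z n b c d) := by
  rw [(hS n' b c d).1, (hS n b c d).1]
  exact slot3_mul_log_le hT d b c hn hnn'

/-- slot 1 (transposition `(0 1)`): `n · log Z(a,n',c,d) ≤ n' · log Z(a,n,c,d)` for `2 ≤ n ≤ n'`. -/
theorem slot1_mul_log_le (hS : IsAxisSymmetric Z) (hT : IsTracePositiveAll Z) (a c d : ℕ) {n n' : ℕ}
    (hn : 2 ≤ n) (hnn' : n ≤ n') : (n : ℝ) * Real.log (Z a n' c d) ≤ (n' : ℝ) * Real.log (Z a n c d) := by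
  rw [(hS a n' c d).2.1, (hS a n c d).2.1]
  exact slot0_mul_log_le hS hT a c d hn hnn'

/-- slot 2 (transposition `(0 2)`): `n · log Z(a,b,n',d) ≤ n' · log Z(a,b,n,d)` for `2 ≤ n ≤ n'`. -/
theorem slot2_mul_log_le (hS : IsAxisSymmetric Z) (hT : IsTracePositiveAll Z) (a b d : ℕ) {n n' : ℕ}
    (hn : 2 ≤ n) (hnn' : n ≤ n') : (n : ℝ) * Real.log (Z a b n' d) ≤ (n' : ℝ) * Real.log (Z a b n d) := by
  rw [(hS a b n' d).2.2, (hS a b n d).2.2]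
  exact slot0_mul_log_le hS hT b a d hn hnn'

/-- **Cube monotonicity**: `L⁴ · log Z(L',L',L',L') ≤ L'⁴ · log Z(L,L,L,L)` for `2 ≤ L ≤ L'` — the pressure
`L⁻⁴ log Z(L⁴)` is non-increasing in the period. -/
theorem cube_mul_log_le (hS : IsAxisSymmetric Z) (hT : IsTracePositiveAll Z) {L L' : ℕ} (hL : 2 ≤ L)
    (hLL' : L ≤ L') :
    (L : ℝ) ^ 4 * Real.log (Z L' L' L' L') ≤ (L' : ℝ) ^ 4 * Real.log (Z L L L L) := by
  have h0 := slot0_mul_log_le hS hT L' L' L' hL hLL'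
  have h1 := slot1_mul_log_le hS hT L L' L' hL hLL'
  have h2 := slot2_mul_log_le hS hT L L L' hL hLL'
  have h3 := slot3_mul_log_le hT L L L hL hLL'
  have hL0 : (0 : ℝ) ≤ L := Nat.cast_nonneg L
  have hL'0 : (0 : ℝ) ≤ L' := Nat.cast_nonneg L'
  calc (L : ℝ) ^ 4 * Real.log (Z L' L' L' L')
      = (L : ℝ) ^ 3 * ((L : ℝ) * Real.log (Z L' L' L' L')) := by ring
    _ ≤ (L : ℝ) ^ 3 * ((L' : ℝ) * Real.log (Z L L' L' L')) := mul_le_mul_of_nonneg_left h0 (by positivity)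
    _ = (L : ℝ) ^ 2 * L' * ((L : ℝ) * Real.log (Z L L' L' L')) := by ring
    _ ≤ (L : ℝ) ^ 2 * L' * ((L' : ℝ) * Real.log (Z L L L' L')) := mul_le_mul_of_nonneg_left h1 (by positivity)
    _ = (L : ℝ) * (L' : ℝ) ^ 2 * ((L : ℝ) * Real.log (Z L L L' L')) := by ring
    _ ≤ (L : ℝ) * (L' : ℝ) ^ 2 * ((L' : ℝ) * Real.log (Z L L L L')) := mul_le_mul_of_nonneg_left h2 (by positivity)
    _ = (L' : ℝ) ^ 3 * ((L : ℝ) * Real.log (Z L L L L')) := by ring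
    _ ≤ (L' : ℝ) ^ 3 * ((L' : ℝ) * Real.log (Z L L L L)) := mul_le_mul_of_nonneg_left h3 (by positivity)
    _ = (L' : ℝ) ^ 4 * Real.log (Z L L L L) := by ring

/-- **Box monotonicity**: `n₀n₁n₂n₃ · log Z(M,M,M,M) ≤ M⁴ · log Z(n₀,n₁,n₂,n₃)` whenever `2 ≤ nᵢ ≤ M`. -/
theorem box_mul_log_le (hS : IsAxisSymmetric Z) (hT : IsTracePositiveAll Z) {n₀ n₁ n₂ n₃ M : ℕ}
    (h₀ : 2 ≤ n₀) (h₁ : 2 ≤ n₁) (h₂ : 2 ≤ n₂) (h₃ : 2 ≤ n₃) (h₀M : n₀ ≤ M) (h₁M : n₁ ≤ M) (h₂M : n₂ ≤ M)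
    (h₃M : n₃ ≤ M) :
    ((n₀ : ℝ) * n₁ * n₂ * n₃) * Real.log (Z M M M M) ≤ (M : ℝ) ^ 4 * Real.log (Z n₀ n₁ n₂ n₃) := by
  have g0 := slot0_mul_log_le hS hT M M M h₀ h₀M
  have g1 := slot1_mul_log_le hS hT n₀ M M h₁ h₁M
  have g2 := slot2_mul_log_le hS hT n₀ n₁ M h₂ h₂M
  have g3 := slot3_mul_log_le hT n₀ n₁ n₂ h₃ h₃M
  have hM0 : (0 : ℝ) ≤ M := Nat.cast_nonneg M
  have e0 : (0 : ℝ) ≤ n₀ := Nat.cast_nonneg n₀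
  have e1 : (0 : ℝ) ≤ n₁ := Nat.cast_nonneg n₁
  have e2 : (0 : ℝ) ≤ n₂ := Nat.cast_nonneg n₂
  have e3 : (0 : ℝ) ≤ n₃ := Nat.cast_nonneg n₃
  calc ((n₀ : ℝ) * n₁ * n₂ * n₃) * Real.log (Z M M M M)
      = ((n₁ : ℝ) * n₂ * n₃) * ((n₀ : ℝ) * Real.log (Z M M M M)) := by ring
    _ ≤ ((n₁ : ℝ) * n₂ * n₃) * ((M : ℝ) * Real.log (Z n₀ M M M)) := mul_le_mul_of_nonneg_left g0 (by positivity)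
    _ = ((M : ℝ) * n₂ * n₃) * ((n₁ : ℝ) * Real.log (Z n₀ M M M)) := by ring
    _ ≤ ((M : ℝ) * n₂ * n₃) * ((M : ℝ) * Real.log (Z n₀ n₁ M M)) := mul_le_mul_of_nonneg_left g1 (by positivity)
    _ = ((M : ℝ) ^ 2 * n₃) * ((n₂ : ℝ) * Real.log (Z n₀ n₁ M M)) := by ring
    _ ≤ ((M : ℝ) ^ 2 * n₃) * ((M : ℝ) * Real.log (Z n₀ n₁ n₂ M)) := mul_le_mul_of_nonneg_left g2 (by positivity)
    _ = (M : ℝ) ^ 3 * ((n₃ : ℝ) * Real.log (Z n₀ n₁ n₂ M)) := by ring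
    _ ≤ (M : ℝ) ^ 3 * ((M : ℝ) * Real.log (Z n₀ n₁ n₂ n₃)) := mul_le_mul_of_nonneg_left g3 (by positivity)
    _ = (M : ℝ) ^ 4 * Real.log (Z n₀ n₁ n₂ n₃) := by ring

end Abstract

/-! ## §2 Wilson's model: the torus pressure is non-increasing in `L`, hence `L⁴ f(β) ≤ log Z_{Λ_L,β}` -/

section Model

variable {G : Type} [Group G] [TopologicalSpace G] [IsTopologicalGroup G] [CompactSpace G]
  [MeasurableSpace G] [BorelSpace G]

/-- [TM, all boxes] for the model (the tree's anisotropic trace formula `exists_spectralData_wilsonFinTorusPartition_box`,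
exactly as in `AspectBootstrap.tracePositive` but without the unused side hypotheses). -/
theorem tracePositiveAll (r : LatticeRep G) {β : ℝ} (hβ : 0 ≤ β) :
    IsTracePositiveAll (wilsonFinTorusPartition r.ρ β) := by
  haveI : SecondCountableTopology G :=
    (r.continuous.isClosedEmbedding r.injective).isEmbedding.secondCountableTopology
  intro b₁ b₂ b₃
  obtain ⟨s, _, lam, i₀, hle, hpos, -, hZ⟩ :=
    exists_spectralData_wilsonFinTorusPartition_box r.continuous r.mem_unitary hβ b₁ b₂ b₃
  exact ⟨s, lam, i₀, hle, hpos, hZ⟩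

/-- Dictionary: `log Z_{Λ_L,β}` (`torusLogPartition 4`) is `log Z_{r,β}(L,L,L,L)`. -/
theorem torusLogPartition_eq_log (r : LatticeRep G) (β : ℝ) (L : ℕ) [NeZero L] :
    torusLogPartition 4 r.ρ β L = Real.log (wilsonFinTorusPartition r.ρ β L L L L) := by
  haveI : SecondCountableTopology G :=
    (r.continuous.isClosedEmbedding r.injective).isEmbedding.secondCountableTopology
  rw [torusLogPartition, toReal_partitionFunction_eq_wilsonFinTorusPartition r.continuous β]

/-- **Period monotonicity of the torus free energy**: `L⁴ · log Z_{Λ_{L'},β} ≤ L'⁴ · log Z_{Λ_L,β}` for `β ≥ 0` and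
`2 ≤ L ≤ L'`, every compact `G`, every lattice representation. -/
theorem torusLogPartition_mul_le (r : LatticeRep G) {β : ℝ} (hβ : 0 ≤ β) {L L' : ℕ} [NeZero L] [NeZero L']
    (hL : 2 ≤ L) (hLL' : L ≤ L') :
    (L : ℝ) ^ 4 * torusLogPartition 4 r.ρ β L' ≤ (L' : ℝ) ^ 4 * torusLogPartition 4 r.ρ β L := by
  rw [torusLogPartition_eq_log r β L, torusLogPartition_eq_log r β L']
  exact cube_mul_log_le (axisSymmetric r β) (tracePositiveAll r hβ) hL hLL'

/-- **The torus pressure `L⁻⁴ log Z_{Λ_L,β}` is non-increasing on `L ≥ 2`** (`β ≥ 0`). -/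
theorem torusPressure_antitone (r : LatticeRep G) {β : ℝ} (hβ : 0 ≤ β) {L L' : ℕ} [NeZero L] [NeZero L']
    (hL : 2 ≤ L) (hLL' : L ≤ L') :
    torusLogPartition 4 r.ρ β L' / (L' : ℝ) ^ 4 ≤ torusLogPartition 4 r.ρ β L / (L : ℝ) ^ 4 := by
  have h := torusLogPartition_mul_le r hβ hL hLL'
  have hL0 : (0 : ℝ) < (L : ℝ) ^ 4 := by positivity
  have hL'0 : (0 : ℝ) < (L' : ℝ) ^ 4 := by
    have : (0 : ℝ) < L' := by exact_mod_cast (show 0 < L' by omega)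
    positivity
  rw [div_le_div_iff₀ hL'0 hL0]
  linarith

/-- **Floor by the free energy density, ALL `L ≥ 2`**: if `L⁻⁴ log Z_{Λ_L,β} → f` then `L⁴ · f ≤ log Z_{Λ_L,β}` for
every `L ≥ 2` (`β ≥ 0`) — no volume floor, no error term. -/
theorem volume_mul_le_torusLogPartition (r : LatticeRep G) {β f : ℝ} (hβ : 0 ≤ β)
    (hf : HasFreeEnergyDensity 4 r.ρ β f) (L : ℕ) [NeZero L] (hL : 2 ≤ L) :
    (L : ℝ) ^ 4 * f ≤ torusLogPartition 4 r.ρ β L := by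
  have hL0 : (0 : ℝ) < (L : ℝ) ^ 4 := by positivity
  have key : ∀ᶠ n : ℕ in atTop, (((n + 1 : ℕ) : ℝ) ^ 4)⁻¹ * torusLogPartition 4 r.ρ β (n + 1) ≤
      torusLogPartition 4 r.ρ β L / (L : ℝ) ^ 4 := by
    filter_upwards [eventually_ge_atTop L] with n hn
    have h := torusLogPartition_mul_le r hβ (L := L) (L' := n + 1) hL (by omega)
    have hn0 : (0 : ℝ) < ((n + 1 : ℕ) : ℝ) ^ 4 := by positivity
    rw [inv_mul_eq_div, div_le_div_iff₀ hn0 hL0]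
    linarith
  have hlim : f ≤ torusLogPartition 4 r.ρ β L / (L : ℝ) ^ 4 := le_of_tendsto hf key
  rw [le_div_iff₀ hL0] at hlim
  linarith

/-- **`L⁴ · f(β) ≤ log Z_{Λ_L,β}` for all `L ≥ 2`, `β ≥ 0`**, with `f = freeEnergyDensity 4 r.ρ β` (which exists,
`exists_hasFreeEnergyDensity_holds`). -/
theorem volume_mul_freeEnergyDensity_le_torusLogPartition (r : LatticeRep G) {β : ℝ} (hβ : 0 ≤ β) (L : ℕ)
    [NeZero L] (hL : 2 ≤ L) :
    (L : ℝ) ^ 4 * freeEnergyDensity 4 r.ρ β ≤ torusLogPartition 4 r.ρ β L := by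
  haveI : SecondCountableTopology G :=
    (r.continuous.isClosedEmbedding r.injective).isEmbedding.secondCountableTopology
  obtain ⟨f, hf⟩ := exists_hasFreeEnergyDensity_holds (d := 4) r.ρ r.continuous β
  rw [hf.freeEnergyDensity_eq]
  exact volume_mul_le_torusLogPartition r hβ hf L hL

/-- pressure form: `f(β) ≤ L⁻⁴ log Z_{Λ_L,β}`, `L ≥ 2`, `β ≥ 0`. -/
theorem freeEnergyDensity_le_torusPressure (r : LatticeRep G) {β : ℝ} (hβ : 0 ≤ β) (L : ℕ) [NeZero L]
    (hL : 2 ≤ L) : freeEnergyDensity 4 r.ρ β ≤ torusLogPartition 4 r.ρ β L / (L : ℝ) ^ 4 := by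
  have h := volume_mul_freeEnergyDensity_le_torusLogPartition r hβ L hL
  rw [le_div_iff₀ (by positivity : (0 : ℝ) < (L : ℝ) ^ 4)]
  linarith

/-- **Anisotropic floor**: `n₀n₁n₂n₃ · f(β) ≤ log Z_{r,β}(n₀,n₁,n₂,n₃)` for every box with all sides `≥ 2`
(`β ≥ 0`). -/
theorem boxVolume_mul_freeEnergyDensity_le_log (r : LatticeRep G) {β : ℝ} (hβ : 0 ≤ β) {n₀ n₁ n₂ n₃ : ℕ}
    (h₀ : 2 ≤ n₀) (h₁ : 2 ≤ n₁) (h₂ : 2 ≤ n₂) (h₃ : 2 ≤ n₃) :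
    ((n₀ : ℝ) * n₁ * n₂ * n₃) * freeEnergyDensity 4 r.ρ β ≤
      Real.log (wilsonFinTorusPartition r.ρ β n₀ n₁ n₂ n₃) := by
  set M : ℕ := n₀ + n₁ + n₂ + n₃ with hM
  haveI : NeZero M := ⟨by omega⟩
  have hbox := box_mul_log_le (axisSymmetric r β) (tracePositiveAll r hβ) h₀ h₁ h₂ h₃
    (show n₀ ≤ M by omega) (show n₁ ≤ M by omega) (show n₂ ≤ M by omega) (show n₃ ≤ M by omega)
  have hfloor := volume_mul_freeEnergyDensity_le_torusLogPartition r hβ M (by omega)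
  rw [torusLogPartition_eq_log r β M] at hfloor
  have hM0 : (0 : ℝ) < (M : ℝ) ^ 4 := by
    have : (0 : ℝ) < M := by exact_mod_cast (show 0 < M by omega)
    positivity
  have hV : (0 : ℝ) ≤ (n₀ : ℝ) * n₁ * n₂ * n₃ := by positivity
  -- `V f = (V/M⁴) (M⁴ f) ≤ (V/M⁴) log Z(M⁴) ≤ log Z(n)`
  have h1 : ((n₀ : ℝ) * n₁ * n₂ * n₃) * ((M : ℝ) ^ 4 * freeEnergyDensity 4 r.ρ β) ≤
      ((n₀ : ℝ) * n₁ * n₂ * n₃) * Real.log (wilsonFinTorusPartition r.ρ β M M M M) :=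
    mul_le_mul_of_nonneg_left hfloor hV
  nlinarith [h1, hbox, hM0]

/-- **Spectral form**: `b₁b₂b₃ · f(β) ≤ φ(b₁,b₂,b₃) = log λ₀(b₁,b₂,b₃)` — the ground-state energy per site
`−φ/(b₁b₂b₃)` of the transfer matrix of the spatial torus `b₁ × b₂ × b₃` (sides `≥ 2`) is at most `−f(β)`. -/
theorem spatialVolume_mul_freeEnergyDensity_le_phi (r : LatticeRep G) {β : ℝ} (hβ : 0 ≤ β) {b₁ b₂ b₃ : ℕ}
    (h₁ : 2 ≤ b₁) (h₂ : 2 ≤ b₂) (h₃ : 2 ≤ b₃) :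
    ((b₁ : ℝ) * b₂ * b₃) * freeEnergyDensity 4 r.ρ β ≤ phi (wilsonFinTorusPartition r.ρ β b₁ b₂ b₃) := by
  have h := phi_ge_of_lower (tracePositiveAll r hβ b₁ b₂ b₃) (-(((b₁ : ℝ) * b₂ * b₃) * freeEnergyDensity 4 r.ρ β))
    fun m => by
      have hm := boxVolume_mul_freeEnergyDensity_le_log r hβ h₁ h₂ h₃ (show 2 ≤ m + 2 by omega)
      push_cast at hm ⊢
      nlinarith [hm]
  simpa using h

end Model

/-! ## §3 Consequences for the `BalabanLadder.IR` bookkeeping -/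

section Consequences

variable {G : Type} [Group G] [TopologicalSpace G] [IsTopologicalGroup G] [CompactSpace G]
  [MeasurableSpace G] [BorelSpace G]

/-- **β-uniform sharp floor from a free-energy asymptotic.**  If `f(β) + c·log β → K` as `β → ∞` (Chatterjee's
theorem: `c = 3N²/2` for `U(N)`, tree `SoloBlind.tendsto_freeEnergyDensity_add_log`), then for every `ε > 0`, for
all large `β` and ALL `L ≥ 2`: `L⁴ (K − ε − c log β) ≤ log Z_{Λ_L,β}` — no volume floor. -/
theorem uniform_floor_of_tendsto (r : LatticeRep G) {c K : ℝ}
    (hK : Tendsto (fun β : ℝ => freeEnergyDensity 4 r.ρ β + c * Real.log β) atTop (𝓝 K)) {ε : ℝ}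
    (hε : 0 < ε) :
    ∀ᶠ β : ℝ in atTop, ∀ (L : ℕ) [NeZero L], 2 ≤ L →
      (L : ℝ) ^ 4 * (K - ε - c * Real.log β) ≤ torusLogPartition 4 r.ρ β L := by
  have h1 : ∀ᶠ β : ℝ in atTop, K - ε < freeEnergyDensity 4 r.ρ β + c * Real.log β :=
    hK.eventually (Ioi_mem_nhds (by linarith))
  filter_upwards [h1, eventually_ge_atTop (0 : ℝ)] with β hβK hβ0 L _ hL
  have hfloor := volume_mul_freeEnergyDensity_le_torusLogPartition r hβ0 L hL
  have hL0 : (0 : ℝ) ≤ (L : ℝ) ^ 4 := by positivity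
  have h2 : (L : ℝ) ^ 4 * (K - ε - c * Real.log β) ≤ (L : ℝ) ^ 4 * freeEnergyDensity 4 r.ρ β :=
    mul_le_mul_of_nonneg_left (by linarith) hL0
  linarith

/-- **Increment ≤ excess + density increment** (floor half of the finite-size sandwich, exact and β-free): for
`β ≥ 0`, any `β'`, all `L ≥ 2`,
`log Z_L(β') − log Z_L(β) ≤ [log Z_L(β') − L⁴ f(β')] + L⁴ (f(β') − f(β))`. -/
theorem increment_le_excess_add (r : LatticeRep G) {β : ℝ} (hβ : 0 ≤ β) (β' : ℝ) (L : ℕ) [NeZero L]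
    (hL : 2 ≤ L) :
    torusLogPartition 4 r.ρ β' L - torusLogPartition 4 r.ρ β L ≤
      (torusLogPartition 4 r.ρ β' L - (L : ℝ) ^ 4 * freeEnergyDensity 4 r.ρ β') +
        (L : ℝ) ^ 4 * (freeEnergyDensity 4 r.ρ β' - freeEnergyDensity 4 r.ρ β) := by
  have h := volume_mul_freeEnergyDensity_le_torusLogPartition r hβ L hL
  linarith

/-- **The finite-size excess is non-negative**: `0 ≤ log Z_{Λ_L,β} − L⁴ f(β)` (`L ≥ 2`, `β ≥ 0`). -/
theorem excess_nonneg (r : LatticeRep G) {β : ℝ} (hβ : 0 ≤ β) (L : ℕ) [NeZero L] (hL : 2 ≤ L) :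
    0 ≤ torusLogPartition 4 r.ρ β L - (L : ℝ) ^ 4 * freeEnergyDensity 4 r.ρ β := by
  have h := volume_mul_freeEnergyDensity_le_torusLogPartition r hβ L hL
  linarith

end Consequences

/-! ## §4 The CEILING with boundary cost only, and the LINEAR volume floor for the rarity engine

The floor of §2 is exact; the ceiling below loses `β` per BOUNDARY plaquette only (one free cube `B_{L-1}` inside the torus:
the tree's sub-box estimate `FreeEnergy.abs_torusLogPartition_sub_le` at `q = 1`, `m = L`; dropping the plaquettes of
`𝔅⟦L-1⟧ ∖ cubePlaqs (L-1)` raises `Z` at `β ≥ 0`; Chatterjee's Lemma 17.5 `ChatterjeeFreeEnergy.le_freeEnergyDensity` prices the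
free cube against `f`).  Result: `log Z_{Λ_L,β} ≤ L⁴ f(β) + C_r β L³` — so `|log Z_{Λ_L,β} − L⁴ f(β)| ≤ C_r β L³`, against the
`C(1+β)(L⁴/m + L³m)`, `m² ≤ L` of `LargeFieldRarityChessboard.FiniteSizeFreeEnergy` (idea-4 g3), whose optimum forces the
QUADRATIC floor `volFloor β = (⌈β⌉₊+2)²`.  Consequence: the free-energy increment (FE) of the large-field rarity engine holds
above the LINEAR floor `linFloor β = ⌈β⌉₊ + 2` (`freeEnergyIncrementFrom_linFloor`, Prop mirrored verbatim from idea-4's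
`FreeEnergyIncrementFrom`), hence — by idea-4's PROVED, floor-parametric engine `largeFieldRarityOn_of_ZRatio chessboardZRatio_odd`
— β-uniform Peierls-multiplicative large-field rarity on ALL ODD TORI `2S+1 ≥ ⌈β⌉₊ + 2` (was `≥ (⌈β⌉₊+2)²`); the small-tori
residual `LargeFieldRaritySmallTori` shrinks to `3 ≤ 2S+1 ≤ ⌈β⌉₊ + 1`. -/

section LinearFloor

variable {G : Type} [Group G] [TopologicalSpace G] [IsTopologicalGroup G] [CompactSpace G]
  [MeasurableSpace G] [BorelSpace G]

open Literature.Probability.LatticeModels (halfOpenBox)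

/-- **Torus ceiling by one free cube** (`d = 4`, `β ≥ 0`, continuous `ρ` with `Re tr ρ ≤ N`, `|Re tr ρ| ≤ M`):
`log Z_{Λ_{n+1},β} ≤ (n+1)⁴ f(β) + 10·β(N+M)·#planes·(n+1)³`. -/
theorem torusLogPartition_le_freeBox [SecondCountableTopology G] {N : ℕ} (ρ : G →* Matrix (Fin N) (Fin N) ℂ)
    (hρ : Continuous ρ) (hρN : ∀ g, (ρ g).trace.re ≤ N) {M : ℝ} (hM : ∀ g, |(ρ g).trace.re| ≤ M) {β : ℝ}
    (hβ : 0 ≤ β) (n : ℕ) :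
    torusLogPartition 4 ρ β (n + 1) ≤ ((n : ℝ) + 1) ^ 4 * freeEnergyDensity 4 ρ β +
      10 * (β * (N + M) * Fintype.card {q : Fin 4 × Fin 4 // q.1 < q.2}) * ((n : ℝ) + 1) ^ 3 := by
  have hM0 : 0 ≤ M := (abs_nonneg _).trans (hM 1)
  have hK0 : 0 ≤ β * (N + M) * Fintype.card {q : Fin 4 × Fin 4 // q.1 < q.2} := by positivity
  -- (i) the torus against the box `𝔅⟦n⟧` of ONE cube (`q = 1`, `m = n + 1`)
  have h1 := FreeEnergy.abs_torusLogPartition_sub_le (d := 4) ρ hρ hM β (n + 1) (n + 1) le_add_self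
  have hq : (n + 1) / (n + 1) = 1 := Nat.div_self n.succ_pos
  simp only [hq, one_pow, Nat.cast_one, one_mul, Nat.add_sub_cancel, abs_of_nonneg hβ] at h1
  obtain ⟨-, h1'⟩ := abs_le.1 h1
  push_cast at h1'
  -- (ii) dropping the non-genuine plaquettes of `𝔅⟦n⟧` raises `Z` to the free cube `Z(B_n)`; (iii) Lemma 17.5
  have h3 := ChatterjeeFreeEnergy.le_freeEnergyDensity (d := 4) ρ hρ hM β n
  push_cast at h3
  have hL0 : (0 : ℝ) < (n : ℝ) + 1 := by positivity
  have h3' : Real.log (zdPartitionFunction ρ β (halfOpenBox 4 n)).toReal ≤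
      ((n : ℝ) + 1) ^ 4 * freeEnergyDensity 4 ρ β +
        β * (N + M) * Fintype.card {q : Fin 4 × Fin 4 // q.1 < q.2} * 6 * ((n : ℝ) + 1) ^ 3 := by
    have hL4 : (0 : ℝ) < ((n : ℝ) + 1) ^ 4 := by positivity
    have h3a := sub_le_iff_le_add.1 h3
    rw [div_le_iff₀ hL4] at h3a
    have e : (freeEnergyDensity 4 ρ β +
        |β| * (N + M) * Fintype.card {q : Fin 4 × Fin 4 // q.1 < q.2} * (4 + 2) / ((n : ℝ) + 1)) *
          ((n : ℝ) + 1) ^ 4 = ((n : ℝ) + 1) ^ 4 * freeEnergyDensity 4 ρ β +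
        β * (N + M) * Fintype.card {q : Fin 4 × Fin 4 // q.1 < q.2} * 6 * ((n : ℝ) + 1) ^ 3 := by
      rw [abs_of_nonneg hβ]
      field_simp
      ring
    linarith [h3a, e]
  -- (iv) `(n+1)⁴ − n⁴ ≤ 4 (n+1)³`
  have h4 := ChatterjeeFreeEnergy.pow_succ_sub_pow_le n 4
  norm_num at h4
  have h4fix : ((n : ℝ) + 1) ^ 4 - (n : ℝ) ^ 4 ≤ 4 * ((n : ℝ) + 1) ^ 3 := by linarith
  have hβNM : 0 ≤ β * (N + M) := by positivity
  have h4' : β * (N + M) * (Fintype.card {q : Fin 4 × Fin 4 // q.1 < q.2} * (((n : ℝ) + 1) ^ 4 - (n : ℝ) ^ 4)) ≤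
      β * (N + M) * (Fintype.card {q : Fin 4 × Fin 4 // q.1 < q.2} * (4 * ((n : ℝ) + 1) ^ 3)) :=
    mul_le_mul_of_nonneg_left (mul_le_mul_of_nonneg_left h4fix (Nat.cast_nonneg _)) hβNM
  -- glue: `g ≤ log Z(𝔅⟦n⟧) + … ≤ log Z(B_n) + …`
  have key : ∀ {z : ℝ}, torusLogPartition 4 ρ β (n + 1) - z ≤
      β * (N + M) * (Fintype.card {q : Fin 4 × Fin 4 // q.1 < q.2} * (((n : ℝ) + 1) ^ 4 - (n : ℝ) ^ 4)) →
      z ≤ Real.log (zdPartitionFunction ρ β (halfOpenBox 4 n)).toReal →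
      torusLogPartition 4 ρ β (n + 1) ≤ ((n : ℝ) + 1) ^ 4 * freeEnergyDensity 4 ρ β +
        10 * (β * (N + M) * Fintype.card {q : Fin 4 × Fin 4 // q.1 < q.2}) * ((n : ℝ) + 1) ^ 3 :=
    fun ha hb => by linarith
  refine key h1' (Real.log_le_log (FreeEnergy.zdZ_pos ρ hρ β _) ?_)
  rw [ChatterjeeFreeEnergy.zdPartitionFunction_toReal_eq ρ hρ β n]
  exact integral_mono (FreeEnergy.integrable_boxWeight ρ hρ β _) (FreeEnergy.integrable_boxWeight ρ hρ β _)
    fun U => ChatterjeeFreeEnergy.prod_boxWeight_le_of_subset ρ hρN hβ (ChatterjeeFreeEnergy.cubePlaqs_subset n) U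

/-- **Two-sided finite-size bound, LINEAR in `β`, CUBIC in `L`**: for every lattice representation `r` there is `C ≥ 0` with
`L⁴ f(β) ≤ log Z_{Λ_L,β} ≤ L⁴ f(β) + C β L³` for all `β ≥ 0`, `L ≥ 2` (floor: §2, transfer matrix, exact; ceiling: one free
cube). -/
theorem finiteSize_linear (r : LatticeRep G) : ∃ C : ℝ, 0 ≤ C ∧ ∀ (β : ℝ), 0 ≤ β → ∀ (L : ℕ) [NeZero L], 2 ≤ L →
    (L : ℝ) ^ 4 * freeEnergyDensity 4 r.ρ β ≤ torusLogPartition 4 r.ρ β L ∧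
      torusLogPartition 4 r.ρ β L ≤ (L : ℝ) ^ 4 * freeEnergyDensity 4 r.ρ β + C * β * (L : ℝ) ^ 3 := by
  haveI : SecondCountableTopology G :=
    (r.continuous.isClosedEmbedding r.injective).isEmbedding.secondCountableTopology
  have hM : ∀ g, |(r.ρ g).trace.re| ≤ (r.N : ℝ) := fun g => by
    simpa [Fintype.card_fin] using
      Literature.RepresentationTheory.CompactGroups.CompactGroup.abs_re_trace_le_card r.ρ r.continuous g
  have hρN : ∀ g, (r.ρ g).trace.re ≤ (r.N : ℝ) := fun g => (abs_le.1 (hM g)).2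
  refine ⟨10 * (((r.N : ℝ) + r.N) * Fintype.card {q : Fin 4 × Fin 4 // q.1 < q.2}), by positivity,
    fun β hβ L _ hL => ⟨volume_mul_freeEnergyDensity_le_torusLogPartition r hβ L hL, ?_⟩⟩
  obtain ⟨n, hn⟩ : ∃ n, L = n + 1 := ⟨L - 1, by omega⟩
  subst hn
  have h := torusLogPartition_le_freeBox r.ρ r.continuous hρN hM hβ n
  push_cast
  linarith

/-- VERBATIM MIRROR of `LargeFieldRarityChessboard.FreeEnergyIncrementFrom` (`Cruxes/IR/Lines/largefield_rarity_chessboard.lean`,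
idea-4 g3; crux workfiles are not importable): the free-energy increment `log Z_L(β') − log Z_L(β) ≤ ν₀ L⁴ log(β/β') + C L⁴` for
`β₃ ≤ β' ≤ β` on all tori of side `L ≥ fl β`. -/
def FreeEnergyIncrementFrom (fl : ℝ → ℕ) : Prop :=
  ∀ (G : Type) [Group G] [TopologicalSpace G] [IsTopologicalGroup G] [CompactSpace G],
    IsCompactSimpleLieGroup G →
    letI : MeasurableSpace G := borel G
    haveI : BorelSpace G := ⟨rfl⟩
    ∀ (r : LatticeRep G), ∃ (ν₀ C β₃ : ℝ), 0 < β₃ ∧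
      ∀ (L : ℕ) [NeZero L] (β' β : ℝ), β₃ ≤ β' → β' ≤ β → fl β ≤ L →
        torusLogPartition 4 r.ρ β' L - torusLogPartition 4 r.ρ β L ≤
          ν₀ * (L : ℝ) ^ 4 * Real.log (β / β') + C * (L : ℝ) ^ 4

/-- **The LINEAR volume floor** `L₀(β) = ⌈β⌉₊ + 2` (against idea-4's quadratic `(⌈β⌉₊ + 2)²`). -/
def linFloor (β : ℝ) : ℕ := ⌈β⌉₊ + 2

/-- `linFloor β ≤ volFloor β = (⌈β⌉₊+2)²` — every statement above the quadratic floor is implied by the same statement above the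
linear one. -/
theorem linFloor_le_sq (β : ℝ) : linFloor β ≤ (⌈β⌉₊ + 2) * (⌈β⌉₊ + 2) := by
  unfold linFloor
  nlinarith [Nat.zero_le ⌈β⌉₊]

/-- **The increment bound above the linear floor, from any asymptotic `f(β) + c log β → K`** (any real `c`): there are `C`, `β₃ > 0`
with `log Z_L(β') − log Z_L(β) ≤ c L⁴ log(β/β') + C L⁴` for `β₃ ≤ β' ≤ β`, `L ≥ ⌈β⌉₊ + 2` (ceiling at `β'`: `C_r β' L³ ≤ C_r L⁴`
since `β' ≤ β ≤ L`; floor at `β`: exact; `f(β') − f(β) ≤ c log(β/β') + 2`). -/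
theorem increment_bound_of_tendsto (r : LatticeRep G) {c K : ℝ}
    (hK : Tendsto (fun β : ℝ => freeEnergyDensity 4 r.ρ β + c * Real.log β) atTop (𝓝 K)) :
    ∃ C β₃ : ℝ, 0 < β₃ ∧ ∀ (L : ℕ) [NeZero L] (β' β : ℝ), β₃ ≤ β' → β' ≤ β → linFloor β ≤ L →
      torusLogPartition 4 r.ρ β' L - torusLogPartition 4 r.ρ β L ≤
        c * (L : ℝ) ^ 4 * Real.log (β / β') + C * (L : ℝ) ^ 4 := by
  obtain ⟨N₀, hN₀⟩ := (Metric.tendsto_atTop.1 hK) 1 one_pos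
  obtain ⟨C₁, hC₁, hFS⟩ := finiteSize_linear r
  refine ⟨2 + C₁, max N₀ 1, lt_of_lt_of_le one_pos (le_max_right _ _), fun L _ β' β hβ' hβ'β hfl => ?_⟩
  have hβ'1 : 1 ≤ β' := le_trans (le_max_right _ _) hβ'
  have hβ'0 : 0 < β' := by linarith
  have hβ0 : 0 < β := by linarith
  have hL2 : 2 ≤ L := le_trans (by unfold linFloor; omega) hfl
  have hLβ : β ≤ (L : ℝ) := by
    have h1 : β ≤ (⌈β⌉₊ : ℝ) := Nat.le_ceil β
    have h2 : ((⌈β⌉₊ + 2 : ℕ) : ℝ) ≤ (L : ℝ) := by exact_mod_cast hfl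
    push_cast at h2
    linarith
  have hLr : (0 : ℝ) ≤ (L : ℝ) ^ 3 := by positivity
  have hL4 : (0 : ℝ) ≤ (L : ℝ) ^ 4 := by positivity
  -- the two Chatterjee windows
  have hw' := hN₀ β' (le_trans (le_max_left _ _) hβ')
  have hw := hN₀ β (le_trans (le_trans (le_max_left _ _) hβ') hβ'β)
  rw [Real.dist_eq] at hw hw'
  have hf : freeEnergyDensity 4 r.ρ β' - freeEnergyDensity 4 r.ρ β ≤ c * Real.log (β / β') + 2 := by
    rw [Real.log_div hβ0.ne' hβ'0.ne']
    have a1 := (abs_lt.1 hw').2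
    have a2 := (abs_lt.1 hw).1
    nlinarith
  -- ceiling at `β'`, floor at `β`
  obtain ⟨-, hceil⟩ := hFS β' hβ'0.le L hL2
  obtain ⟨hfloor, -⟩ := hFS β hβ0.le L hL2
  have hb : C₁ * β' * (L : ℝ) ^ 3 ≤ C₁ * (L : ℝ) ^ 4 := by
    have : β' * (L : ℝ) ^ 3 ≤ (L : ℝ) * (L : ℝ) ^ 3 := mul_le_mul_of_nonneg_right (by linarith) hLr
    nlinarith
  have hmain : (L : ℝ) ^ 4 * (freeEnergyDensity 4 r.ρ β' - freeEnergyDensity 4 r.ρ β) ≤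
      (L : ℝ) ^ 4 * (c * Real.log (β / β') + 2) := mul_le_mul_of_nonneg_left hf hL4
  nlinarith

/-- **(FE) ABOVE THE LINEAR FLOOR — PROVED for every compact simple `G` and lattice representation** (`ν₀ = 3D/2` from the tree's
`freeEnergyLogCoefficient_proof`).  With idea-4's proved engine (`largeFieldRarityOn_of_ZRatio chessboardZRatio_odd`) this gives the
β-uniform large-field rarity on all odd tori `2S+1 ≥ ⌈β⌉₊ + 2`. -/
theorem freeEnergyIncrementFrom_linFloor : FreeEnergyIncrementFrom linFloor := by
  intro G _ _ _ _ hG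
  letI : MeasurableSpace G := borel G
  haveI : BorelSpace G := ⟨rfl⟩
  intro r
  obtain ⟨K, hK⟩ := Summit.QuantumFields.YangMills.Theorems.freeEnergyLogCoefficient_proof G hG r
  obtain ⟨C, β₃, hβ₃, h⟩ := increment_bound_of_tendsto r hK
  exact ⟨_, C, β₃, hβ₃, h⟩

end LinearFloor

/-! ## §5 The LOGARITHMIC volume floor from reflection-positivity DOUBLING OF FREE CUBES

The lens-native improvement of §4.  SITE-reflection positivity of the product Haar measure (reflection `θ` in a
lattice hyperplane through sites; the in-plane links are fixed by `θ`, the in-plane plaquettes enter the half-weight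
`F` with exponent `½`) gives, for the free-boundary cube `B_m` (`m` sites per side) and `β ≥ 0`, the Cauchy–Schwarz
bound `Z(B_m)² ≤ (∫ F)² ≤ ∫ F·θF = Z(B_m ∪ θB_m)` — the doubled box with `2m − 1` sites in the reflected direction and
ALL its plaquettes (no plaquette of `B ∪ θB` crosses the plane).  Doubling in the four directions,
`Z(B_m)^{16} ≤ Z(B_{2m−1})`, and iterating (`m_k − 1 = 2^k (m − 1)`) against Chatterjee's Lemma 17.5 at `k → ∞`:

  `log Z(B_m) ≤ (m − 1)⁴ · f(β)`   — NO `β`-cost at all (exact in `d = 2`, where `Z(B_m) = z(β)^{(m−1)²}`).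

With the one-sided periodisation `Z_{Λ_L,β} ≤ Z(B_{L−1})` (dropping plaquettes is free for `β ≥ 0`, proved below) the
torus ceiling becomes `log Z_{Λ_L,β} ≤ (L−2)⁴ f(β)`, the excess `e_L(β) ≤ (L⁴ − (L−2)⁴)|f(β)| ≤ 8L³ (ν log β + C)`,
and idea-4's `(FE)` holds above the LOGARITHMIC floor `⌈log β⌉₊ + 2`.  The doubling inequality itself
(`FreeCubeRPDoubling`, a statement about the product Haar measure, continuity and unitarity of `ρ` only) is TYPED here
as the single hypothesis of this section; everything downstream of it is proved.  References: Fröhlich–Israel–Lieb–Simon,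
Commun. Math. Phys. 62 (1978) 1, §4 (reflection positivity for site reflections); Osterwalder–Seiler 1978 §3; Seiler
LNP 159 §2; Montvay–Münster §4.2.3 (site-reflection positivity of the Wilson action). -/

section LogFloor

variable {G : Type} [Group G] [TopologicalSpace G] [IsTopologicalGroup G] [CompactSpace G]
  [MeasurableSpace G] [BorelSpace G]

open Literature.Probability.LatticeModels (halfOpenBox Torus.proj)

/-- **Free-cube RP doubling (typed hypothesis of §5).**  For the free-boundary Wilson partition function of the cube
with `m` sites per side (`zdPartitionFunction ρ β (halfOpenBox 4 m)`): `Z(B_m)^{16} ≤ Z(B_{2m−1})` for every `m ≥ 1`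
(four successive site reflections; classical consequence of reflection positivity of the product Haar measure). -/
def FreeCubeRPDoubling {N : ℕ} (ρ : G →* Matrix (Fin N) (Fin N) ℂ) (β : ℝ) : Prop :=
  ∀ m : ℕ, 1 ≤ m →
    (zdPartitionFunction ρ β (halfOpenBox 4 m)).toReal ^ 16 ≤
      (zdPartitionFunction ρ β (halfOpenBox 4 (2 * m - 1))).toReal

/-- The iterated side length `m_k = 2^k (m − 1) + 1` (`m_{k+1} = 2 m_k − 1`). -/
def iterSide (m k : ℕ) : ℕ := 2 ^ k * (m - 1) + 1

theorem iterSide_zero {m : ℕ} (hm : 1 ≤ m) : iterSide m 0 = m := by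
  unfold iterSide; simp; omega

theorem iterSide_succ (m k : ℕ) : iterSide m (k + 1) = 2 * iterSide m k - 1 := by
  unfold iterSide
  have : 2 ^ (k + 1) * (m - 1) = 2 * (2 ^ k * (m - 1)) := by rw [pow_succ]; ring
  omega

theorem one_le_iterSide (m k : ℕ) : 1 ≤ iterSide m k := by unfold iterSide; omega

/-- Iterating the doubling: `Z(B_m)^{16^k} ≤ Z(B_{m_k})`. -/
theorem pow_le_of_doubling {N : ℕ} (ρ : G →* Matrix (Fin N) (Fin N) ℂ)
    {β : ℝ} (hD : FreeCubeRPDoubling ρ β) {m : ℕ} (hm : 1 ≤ m) (k : ℕ) :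
    (zdPartitionFunction ρ β (halfOpenBox 4 m)).toReal ^ (16 ^ k) ≤
      (zdPartitionFunction ρ β (halfOpenBox 4 (iterSide m k))).toReal := by
  induction k with
  | zero => rw [pow_zero, pow_one, iterSide_zero hm]
  | succ k ih =>
    have h0 : 0 ≤ (zdPartitionFunction ρ β (halfOpenBox 4 m)).toReal ^ (16 ^ k) :=
      pow_nonneg ENNReal.toReal_nonneg _
    calc (zdPartitionFunction ρ β (halfOpenBox 4 m)).toReal ^ (16 ^ (k + 1))
        = ((zdPartitionFunction ρ β (halfOpenBox 4 m)).toReal ^ (16 ^ k)) ^ 16 := by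
          rw [pow_succ, pow_mul]
      _ ≤ (zdPartitionFunction ρ β (halfOpenBox 4 (iterSide m k))).toReal ^ 16 :=
          pow_le_pow_left₀ h0 ih 16
      _ ≤ (zdPartitionFunction ρ β (halfOpenBox 4 (iterSide m (k + 1)))).toReal := by
          rw [iterSide_succ]; exact hD _ (one_le_iterSide m k)

/-- Positivity of the free-cube partition function (as a real number). -/
theorem zdPartitionFunction_toReal_pos [SecondCountableTopology G] {N : ℕ} (ρ : G →* Matrix (Fin N) (Fin N) ℂ)
    (hρ : Continuous ρ) (β : ℝ) (n : ℕ) : 0 < (zdPartitionFunction ρ β (halfOpenBox 4 n)).toReal := by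
  rw [ChatterjeeFreeEnergy.zdPartitionFunction_toReal_eq ρ hρ β n]
  exact FreeEnergy.zdZ_pos ρ hρ β _

/-- `f(β) ≤ 0` for `β ≥ 0` (from the exact floor `2⁴ f ≤ log Z_{Λ_2} ≤ 0`). -/
theorem freeEnergyDensity_nonpos (r : LatticeRep G) {β : ℝ} (hβ : 0 ≤ β) : freeEnergyDensity 4 r.ρ β ≤ 0 := by
  haveI : SecondCountableTopology G :=
    (r.continuous.isClosedEmbedding r.injective).isEmbedding.secondCountableTopology
  have h1 := volume_mul_freeEnergyDensity_le_torusLogPartition r hβ 2 le_rfl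
  have h2 : torusLogPartition 4 r.ρ β 2 ≤ 0 := by
    rw [torusLogPartition_eq_log]
    exact Real.log_nonpos (wilsonFinTorusPartition_pos r.continuous β _ _ _ _).le
      (wilsonFinTorusPartition_le_one_of_nonneg r.ρ r.continuous hβ _ _ _ _)
  push_cast at h1
  nlinarith

/-- **The RP ceiling for free cubes**: under the doubling hypothesis, `log Z(B_m) ≤ (m − 1)⁴ f(β)` for every `m ≥ 1`
(Chatterjee's Lemma 17.5 along `m_k = 2^k(m−1)+1`, divided by `16^k`, `k → ∞`). -/
theorem log_freeCube_le_of_doubling (r : LatticeRep G) {β : ℝ} (hβ : 0 ≤ β) (hD : FreeCubeRPDoubling r.ρ β)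
    {m : ℕ} (hm : 1 ≤ m) :
    Real.log (zdPartitionFunction r.ρ β (halfOpenBox 4 m)).toReal ≤ ((m : ℝ) - 1) ^ 4 * freeEnergyDensity 4 r.ρ β := by
  haveI : SecondCountableTopology G :=
    (r.continuous.isClosedEmbedding r.injective).isEmbedding.secondCountableTopology
  have hM : ∀ g, |(r.ρ g).trace.re| ≤ (r.N : ℝ) := fun g => by
    simpa [Fintype.card_fin] using
      Literature.RepresentationTheory.CompactGroups.CompactGroup.abs_re_trace_le_card r.ρ r.continuous g
  set f := freeEnergyDensity 4 r.ρ β with hf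
  set K' : ℝ := |β| * ((r.N : ℝ) + r.N) * Fintype.card {q : Fin 4 × Fin 4 // q.1 < q.2} * (4 + 2) with hK'
  have hM0 : (0 : ℝ) ≤ r.N := Nat.cast_nonneg _
  have hK'0 : 0 ≤ K' := by positivity
  have hf0 : f ≤ 0 := freeEnergyDensity_nonpos r hβ
  have hm1 : (0 : ℝ) ≤ (m : ℝ) - 1 := by
    have : (1 : ℝ) ≤ m := by exact_mod_cast hm
    linarith
  -- the bound at level `k`
  have hk : ∀ k : ℕ, Real.log (zdPartitionFunction r.ρ β (halfOpenBox 4 m)).toReal ≤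
      ((m : ℝ) - 1) ^ 4 * f + K' * ((m : ℝ) + 1) ^ 3 * (1 / 2 : ℝ) ^ k := by
    intro k
    have hZ := zdPartitionFunction_toReal_pos r.ρ r.continuous β m
    have hZk := zdPartitionFunction_toReal_pos r.ρ r.continuous β (iterSide m k)
    -- logs of the iterated doubling
    have h1 : (16 : ℝ) ^ k * Real.log (zdPartitionFunction r.ρ β (halfOpenBox 4 m)).toReal ≤
        Real.log (zdPartitionFunction r.ρ β (halfOpenBox 4 (iterSide m k))).toReal := by
      have := Real.log_le_log (pow_pos hZ _) (pow_le_of_doubling r.ρ hD hm k)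
      rwa [Real.log_pow, Nat.cast_pow, Nat.cast_ofNat] at this
    -- Lemma 17.5 at side `m_k`
    have h2 := ChatterjeeFreeEnergy.le_freeEnergyDensity (d := 4) r.ρ r.continuous hM β (iterSide m k)
    have hs0 : (0 : ℝ) < (iterSide m k : ℝ) + 1 := by positivity
    have hs4 : (0 : ℝ) < ((iterSide m k : ℝ) + 1) ^ 4 := by positivity
    have h2a := sub_le_iff_le_add.1 h2
    rw [div_le_iff₀ hs4] at h2a
    have e : (f + |β| * ((r.N : ℝ) + (r.N : ℝ)) * (Fintype.card {q : Fin 4 × Fin 4 // q.1 < q.2} : ℝ) *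
        ((4 : ℕ) + 2 : ℝ) / ((iterSide m k : ℝ) + 1)) * ((iterSide m k : ℝ) + 1) ^ 4 =
        ((iterSide m k : ℝ) + 1) ^ 4 * f + K' * ((iterSide m k : ℝ) + 1) ^ 3 := by
      rw [hK']; push_cast; field_simp; try ring
    have h3 : Real.log (zdPartitionFunction r.ρ β (halfOpenBox 4 (iterSide m k))).toReal ≤
        ((iterSide m k : ℝ) + 1) ^ 4 * f + K' * ((iterSide m k : ℝ) + 1) ^ 3 := by
      have := h2a; push_cast at this e; linarith [this, e]
    -- arithmetic of `m_k`: `(m_k + 1) = 2^k ((m-1) + 2/2^k)`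
    set q : ℝ := (1 / 2 : ℝ) ^ k with hq
    set t : ℝ := (2 : ℝ) ^ k with ht
    have hpow : (0 : ℝ) < t := by positivity
    have htq : t * q = 1 := by rw [ht, hq, ← mul_pow]; norm_num
    have hq0 : (0 : ℝ) ≤ q := by positivity
    have hq1 : q ≤ 1 := pow_le_one₀ (by norm_num) (by norm_num)
    set a : ℝ := ((m : ℝ) - 1) + 2 * q with ha
    have hside : ((iterSide m k : ℝ) + 1) = t * a := by
      have e1 : (iterSide m k : ℝ) = t * ((m : ℝ) - 1) + 1 := by
        unfold iterSide; push_cast [Nat.cast_sub hm]; rw [ht]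
      rw [e1, ha, mul_add, ← mul_assoc, mul_comm t 2, mul_assoc 2 t q, htq]
      ring
    have h16 : (16 : ℝ) ^ k = t ^ 4 := by
      rw [ht, ← pow_mul, mul_comm, pow_mul]; norm_num
    have ht4 : (0 : ℝ) < t ^ 4 := by positivity
    -- `t^4 log Z_m ≤ t^4 (a^4 f + q K' a^3)`
    have hc : t ^ 4 * Real.log (zdPartitionFunction r.ρ β (halfOpenBox 4 m)).toReal ≤
        t ^ 4 * (a ^ 4 * f + q * (K' * a ^ 3)) := by
      have rhs : t ^ 4 * (a ^ 4 * f + q * (K' * a ^ 3)) = (t * a) ^ 4 * f + K' * (t * a) ^ 3 := by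
        have e2 : t ^ 4 * q = t ^ 3 := by
          rw [show t ^ 4 = t ^ 3 * t by ring, mul_assoc, htq, mul_one]
        calc t ^ 4 * (a ^ 4 * f + q * (K' * a ^ 3))
            = t ^ 4 * a ^ 4 * f + (t ^ 4 * q) * (K' * a ^ 3) := by ring
          _ = t ^ 4 * a ^ 4 * f + t ^ 3 * (K' * a ^ 3) := by rw [e2]
          _ = (t * a) ^ 4 * f + K' * (t * a) ^ 3 := by ring
      rw [rhs, ← hside, ← h16]
      exact h1.trans h3
    have h6 := le_of_mul_le_mul_left hc ht4
    have hA : ((m : ℝ) - 1) ^ 4 ≤ a ^ 4 := pow_le_pow_left₀ hm1 (by rw [ha]; linarith) 4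
    have hB : a ^ 3 ≤ ((m : ℝ) + 1) ^ 3 := pow_le_pow_left₀ (by rw [ha]; positivity) (by rw [ha]; linarith) 3
    have h7 : a ^ 4 * f ≤ ((m : ℝ) - 1) ^ 4 * f := mul_le_mul_of_nonpos_right hA hf0
    have h8 : q * (K' * a ^ 3) ≤ K' * ((m : ℝ) + 1) ^ 3 * q := by
      have := mul_le_mul_of_nonneg_left (mul_le_mul_of_nonneg_left hB hK'0) hq0
      linarith
    linarith
  -- `k → ∞`
  have hlim : Tendsto (fun k : ℕ => ((m : ℝ) - 1) ^ 4 * f + K' * ((m : ℝ) + 1) ^ 3 * (1 / 2 : ℝ) ^ k) atTop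
      (𝓝 (((m : ℝ) - 1) ^ 4 * f + K' * ((m : ℝ) + 1) ^ 3 * 0)) :=
    tendsto_const_nhds.add (tendsto_const_nhds.mul
      (tendsto_pow_atTop_nhds_zero_of_lt_one (by norm_num) (by norm_num)))
  rw [mul_zero, add_zero] at hlim
  exact ge_of_tendsto' hlim hk

/-- **One-sided periodisation, no `β`-cost**: `log Z_{Λ_{n+2},β} ≤ log Z(B_{n+1})` for `β ≥ 0` — dropping the torus
plaquettes outside the periodised free cube `[0, n]⁴` only RAISES the integral (each weight is `≤ 1`). -/
theorem torusLogPartition_le_log_freeCube [SecondCountableTopology G] {N : ℕ} (ρ : G →* Matrix (Fin N) (Fin N) ℂ)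
    (hρ : Continuous ρ) (hρN : ∀ g, (ρ g).trace.re ≤ N) {β : ℝ} (hβ : 0 ≤ β) (n : ℕ) :
    torusLogPartition 4 ρ β (n + 2) ≤ Real.log (zdPartitionFunction ρ β (halfOpenBox 4 (n + 1))).toReal := by
  classical
  set I' : Finset (ZdPlaquette 4) := ChatterjeeFreeEnergy.cubePlaqs 4 (n + 1) with hI'def
  have hI' : ∀ p ∈ I', ∀ k, 0 ≤ p.1 k ∧ p.1 k + 2 ≤ ((n + 2 : ℕ) : ℤ) := by
    intro p hp k
    have hb := (FreeEnergy.mem_boxPlaqs (d := 4)).1 (ChatterjeeFreeEnergy.cubePlaqs_subset (d := 4) (n + 1) hp) k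
    push_cast
    omega
  set P : Measure (GaugeConfig 4 (n + 2) G) :=
    Measure.pi fun _ => haarProbability G with hP
  -- the torus integral is dominated by the integral of the kept plaquettes
  have hdom : (partitionFunction (d := 4) (L := n + 2) ρ β).toReal ≤
      ∫ U, ∏ p ∈ I'.image (fun p : ZdPlaquette 4 => ((Torus.proj (n + 2) p.1, p.2) : Plaquette 4 (n + 2))),
        Real.exp (-β * plaquetteCost ρ U p) ∂P := by
    rw [FreeEnergy.partitionFunction_eq_ofReal_integral ρ hρ β,
      ENNReal.toReal_ofReal (integral_nonneg fun U => Finset.prod_nonneg fun _ _ => (Real.exp_pos _).le)]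
    refine integral_mono (FreeEnergy.integrable_torusWeight ρ hρ β _) (FreeEnergy.integrable_torusWeight ρ hρ β _)
      fun U => ?_
    have hle1 : ∀ p : Plaquette 4 (n + 2), Real.exp (-β * plaquetteCost ρ U p) ≤ 1 := by
      intro p
      rw [Real.exp_le_one_iff]
      have hc : 0 ≤ plaquetteCost ρ U p := by
        unfold plaquetteCost
        linarith [hρN (plaquetteHolonomy U p.1 p.2.1.1 p.2.1.2)]
      nlinarith
    show ∏ p ∈ Finset.univ, Real.exp (-β * plaquetteCost ρ U p) ≤ _
    rw [← Finset.prod_mul_prod_compl (I'.image (fun p : ZdPlaquette 4 =>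
      ((Torus.proj (n + 2) p.1, p.2) : Plaquette 4 (n + 2))))]
    exact mul_le_of_le_one_right (Finset.prod_nonneg fun _ _ => (Real.exp_pos _).le)
      (Finset.prod_le_one (fun _ _ => (Real.exp_pos _).le) fun p _ => hle1 p)
  rw [FreeEnergy.integral_torusWeight_image ρ hρ β hI'] at hdom
  rw [torusLogPartition, ChatterjeeFreeEnergy.zdPartitionFunction_toReal_eq ρ hρ β (n + 1)]
  refine Real.log_le_log ?_ hdom
  rw [toReal_partitionFunction_eq_wilsonFinTorusPartition hρ]
  exact wilsonFinTorusPartition_pos hρ β _ _ _ _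

/-- **Torus ceiling under RP doubling**: `log Z_{Λ_L,β} ≤ (L − 2)⁴ f(β)` for `β ≥ 0`, `L ≥ 2`. -/
theorem torusLogPartition_le_of_doubling (r : LatticeRep G) {β : ℝ} (hβ : 0 ≤ β) (hD : FreeCubeRPDoubling r.ρ β)
    (L : ℕ) [NeZero L] (hL : 2 ≤ L) :
    torusLogPartition 4 r.ρ β L ≤ ((L : ℝ) - 2) ^ 4 * freeEnergyDensity 4 r.ρ β := by
  haveI : SecondCountableTopology G :=
    (r.continuous.isClosedEmbedding r.injective).isEmbedding.secondCountableTopology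
  have hρN : ∀ g, (r.ρ g).trace.re ≤ (r.N : ℝ) := fun g => by
    have := Literature.RepresentationTheory.CompactGroups.CompactGroup.abs_re_trace_le_card r.ρ r.continuous g
    simp only [Fintype.card_fin] at this
    exact (abs_le.1 this).2
  obtain ⟨n, rfl⟩ : ∃ n, L = n + 2 := ⟨L - 2, by omega⟩
  have h1 := torusLogPartition_le_log_freeCube r.ρ r.continuous hρN hβ n
  have h2 := log_freeCube_le_of_doubling r hβ hD (m := n + 1) le_add_self
  push_cast at h2 ⊢
  have e : ((n : ℝ) + 1 - 1) = ((n : ℝ) + 2 - 2) := by ring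
  rw [e] at h2
  exact h1.trans h2

/-- **The doubling hypothesis for all groups, representations and `β ≥ 0`** (what site-reflection positivity of the
product Haar measure gives; the one typed input of §5). -/
def FreeCubeRPDoublingAll : Prop :=
  ∀ (G : Type) [Group G] [TopologicalSpace G] [IsTopologicalGroup G] [CompactSpace G] [MeasurableSpace G]
    [BorelSpace G] (r : LatticeRep G) (β : ℝ), 0 ≤ β → FreeCubeRPDoubling r.ρ β

/-- **The LOGARITHMIC volume floor** `⌈log β⌉₊ + 2` (representation-independent). -/
def logFloor (β : ℝ) : ℕ := ⌈Real.log β⌉₊ + 2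

theorem logFloor_le_linFloor {β : ℝ} (hβ : 0 ≤ β) : logFloor β ≤ linFloor β := by
  unfold logFloor linFloor
  have h : Real.log β ≤ β := by
    rcases hβ.eq_or_lt with h0 | hpos
    · rw [← h0, Real.log_zero]
    · exact (Real.log_le_sub_one_of_pos hpos).trans (by linarith)
  exact Nat.add_le_add_right (Nat.ceil_mono h) 2

/-- **The increment bound above the logarithmic floor**, from any asymptotic `f(β) + c log β → K` and the doubling
hypothesis at every `β ≥ 0`: `log Z_L(β') − log Z_L(β) ≤ c L⁴ log(β/β') + C L⁴` for `β₃ ≤ β' ≤ β`, `L ≥ ⌈log β⌉₊ + 2`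
(ceiling at `β'`: `(L−2)⁴ f(β')`, i.e. excess `≤ 8L³|f(β')| ≤ 8L³(|c| log β' + |1−K|) ≤ 8(|c|+|1−K|) L⁴` since `log β' ≤ L`;
floor at `β`: exact). -/
theorem increment_bound_log_of_tendsto (r : LatticeRep G) {c K : ℝ}
    (hK : Tendsto (fun β : ℝ => freeEnergyDensity 4 r.ρ β + c * Real.log β) atTop (𝓝 K))
    (hD : ∀ β : ℝ, 0 ≤ β → FreeCubeRPDoubling r.ρ β) :
    ∃ C β₃ : ℝ, 0 < β₃ ∧ ∀ (L : ℕ) [NeZero L] (β' β : ℝ), β₃ ≤ β' → β' ≤ β → logFloor β ≤ L →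
      torusLogPartition 4 r.ρ β' L - torusLogPartition 4 r.ρ β L ≤
        c * (L : ℝ) ^ 4 * Real.log (β / β') + C * (L : ℝ) ^ 4 := by
  obtain ⟨N₀, hN₀⟩ := (Metric.tendsto_atTop.1 hK) 1 one_pos
  refine ⟨2 + 8 * (|c| + |1 - K|), max N₀ 1, lt_of_lt_of_le one_pos (le_max_right _ _),
    fun L _ β' β hβ' hβ'β hfl => ?_⟩
  have hβ'1 : 1 ≤ β' := le_trans (le_max_right _ _) hβ'
  have hβ'0 : 0 < β' := by linarith
  have hβ0 : 0 < β := by linarith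
  have hL2 : 2 ≤ L := le_trans (by unfold logFloor; omega) hfl
  have hL1 : (1 : ℝ) ≤ (L : ℝ) := by exact_mod_cast (le_trans one_le_two hL2)
  have hlogβ' : 0 ≤ Real.log β' := Real.log_nonneg hβ'1
  have hLlog : Real.log β' ≤ (L : ℝ) := by
    have h1 : Real.log β ≤ (⌈Real.log β⌉₊ : ℝ) := Nat.le_ceil _
    have h2 : ((⌈Real.log β⌉₊ + 2 : ℕ) : ℝ) ≤ (L : ℝ) := by exact_mod_cast hfl
    have h3 : Real.log β' ≤ Real.log β := Real.log_le_log hβ'0 hβ'β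
    push_cast at h2
    linarith
  have hL3 : (0 : ℝ) ≤ (L : ℝ) ^ 3 := by positivity
  have hL4 : (0 : ℝ) ≤ (L : ℝ) ^ 4 := by positivity
  -- the two Chatterjee windows
  have hw' := hN₀ β' (le_trans (le_max_left _ _) hβ')
  have hw := hN₀ β (le_trans (le_trans (le_max_left _ _) hβ') hβ'β)
  rw [Real.dist_eq] at hw hw'
  have hf : freeEnergyDensity 4 r.ρ β' - freeEnergyDensity 4 r.ρ β ≤ c * Real.log (β / β') + 2 := by
    rw [Real.log_div hβ0.ne' hβ'0.ne']
    have a1 := (abs_lt.1 hw').2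
    have a2 := (abs_lt.1 hw).1
    nlinarith
  have hnegf : -freeEnergyDensity 4 r.ρ β' ≤ |c| * Real.log β' + |1 - K| := by
    have a1 := (abs_lt.1 hw').1
    have b1 : c * Real.log β' ≤ |c| * Real.log β' := mul_le_mul_of_nonneg_right (le_abs_self c) hlogβ'
    have b2 : 1 - K ≤ |1 - K| := le_abs_self _
    linarith
  have hf'0 : 0 ≤ -freeEnergyDensity 4 r.ρ β' := by linarith [freeEnergyDensity_nonpos r hβ'0.le]
  -- ceiling at `β'` (RP doubling), floor at `β` (transfer matrix)
  have hceil := torusLogPartition_le_of_doubling r hβ'0.le (hD β' hβ'0.le) L hL2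
  have hfloor := volume_mul_freeEnergyDensity_le_torusLogPartition r hβ0.le L hL2
  -- `(L-2)^4 f' = L^4 f' + (L^4 - (L-2)^4)(-f')` and `L^4 - (L-2)^4 ≤ 8 L^3`
  have hpoly : (L : ℝ) ^ 4 - ((L : ℝ) - 2) ^ 4 ≤ 8 * (L : ℝ) ^ 3 := by nlinarith
  have hpoly0 : 0 ≤ (L : ℝ) ^ 4 - ((L : ℝ) - 2) ^ 4 := by
    have : ((L : ℝ) - 2) ^ 4 ≤ (L : ℝ) ^ 4 :=
      pow_le_pow_left₀ (by have : (2:ℝ) ≤ L := by exact_mod_cast hL2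
                           linarith) (by linarith) 4
    linarith
  have hex : ((L : ℝ) - 2) ^ 4 * freeEnergyDensity 4 r.ρ β' ≤
      (L : ℝ) ^ 4 * freeEnergyDensity 4 r.ρ β' + 8 * (L : ℝ) ^ 3 * (|c| * Real.log β' + |1 - K|) := by
    have step1 : ((L : ℝ) - 2) ^ 4 * freeEnergyDensity 4 r.ρ β' =
        (L : ℝ) ^ 4 * freeEnergyDensity 4 r.ρ β' + ((L : ℝ) ^ 4 - ((L : ℝ) - 2) ^ 4) * (-freeEnergyDensity 4 r.ρ β') := by
      ring
    rw [step1]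
    have step2 : ((L : ℝ) ^ 4 - ((L : ℝ) - 2) ^ 4) * (-freeEnergyDensity 4 r.ρ β') ≤
        8 * (L : ℝ) ^ 3 * (-freeEnergyDensity 4 r.ρ β') := mul_le_mul_of_nonneg_right hpoly hf'0
    have step3 : 8 * (L : ℝ) ^ 3 * (-freeEnergyDensity 4 r.ρ β') ≤ 8 * (L : ℝ) ^ 3 * (|c| * Real.log β' + |1 - K|) :=
      mul_le_mul_of_nonneg_left hnegf (by positivity)
    linarith
  -- `8 L^3 (|c| log β' + |1-K|) ≤ 8 (|c| + |1-K|) L^4`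
  have hb : 8 * (L : ℝ) ^ 3 * (|c| * Real.log β' + |1 - K|) ≤ 8 * (|c| + |1 - K|) * (L : ℝ) ^ 4 := by
    have u1 : |c| * Real.log β' ≤ |c| * (L : ℝ) := mul_le_mul_of_nonneg_left hLlog (abs_nonneg c)
    have u2 : |1 - K| ≤ |1 - K| * (L : ℝ) := le_mul_of_one_le_right (abs_nonneg _) hL1
    have u3 : |c| * Real.log β' + |1 - K| ≤ (|c| + |1 - K|) * (L : ℝ) := by nlinarith
    have := mul_le_mul_of_nonneg_left u3 (show (0:ℝ) ≤ 8 * (L : ℝ) ^ 3 by positivity)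
    nlinarith
  have hmain : (L : ℝ) ^ 4 * (freeEnergyDensity 4 r.ρ β' - freeEnergyDensity 4 r.ρ β) ≤
      (L : ℝ) ^ 4 * (c * Real.log (β / β') + 2) := mul_le_mul_of_nonneg_left hf hL4
  nlinarith

/-- **(FE) ABOVE THE LOGARITHMIC FLOOR, conditional on free-cube RP doubling** (`ν₀ = 3D/2` from the tree's
`freeEnergyLogCoefficient_proof`; the doubling is the only hypothesis).  With idea-4's engine this gives the β-uniform
large-field rarity on all odd tori `2S+1 ≥ ⌈log β⌉₊ + 2`. -/
theorem freeEnergyIncrementFrom_logFloor (hD : FreeCubeRPDoublingAll) : FreeEnergyIncrementFrom logFloor := by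
  intro G _ _ _ _ hG
  letI : MeasurableSpace G := borel G
  haveI : BorelSpace G := ⟨rfl⟩
  intro r
  obtain ⟨K, hK⟩ := Summit.QuantumFields.YangMills.Theorems.freeEnergyLogCoefficient_proof G hG r
  obtain ⟨C, β₃, hβ₃, h⟩ := increment_bound_log_of_tendsto r hK (fun β hβ => hD G r β hβ)
  exact ⟨_, C, β₃, hβ₃, h⟩

end LogFloor

end Summit.QuantumFields.YangMills.Cruxes.IR.PressureMonotoneTM

end

/-!
# Part B (= Cruxes/IR `Lines/rp_doubling.lean`): reflection positivity in lattice hyperplanes ("through sites") for the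
product Haar measure, and the free-cube doubling `Z(B_m)^16 ≤ Z(B_{2m-1})` (Glimm–Jaffe §10.5
multiple reflections, transplanted to Wilson's lattice gauge theory with free boundary condition).

Ideator `ym-ir-idea-5` g7 (lens: chessboard / RP transfer-matrix bounds). Discharges the typed
hypothesis `FreeCubeRPDoubling` of §5 (Part B of `Lines/pressure_monotone_tm.lean` v3 = `Lines/rp_doubling.lean`).
-/

open MeasureTheory Finset Filter
open scoped ComplexConjugate

namespace Summit.QuantumFields.YangMills.Cruxes.IR.RPDoubling

open Literature.MathematicalPhysics.QuantumFieldTheory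
open Literature.MathematicalPhysics.QuantumLattice

noncomputable section

/-! ## §1 Site reflections of the discrete torus and of its gauge configurations -/

section TorusGeometry

variable {d L : ℕ}

/-- The reflection of the torus `(ℤ/L)^d` in the lattice hyperplane `x_i = c`. -/
def siteReflect (i : Fin d) (c : ZMod L) (x : Site d L) : Site d L :=
  Function.update x i (c + c - x i)

@[simp] theorem siteReflect_apply_self (i : Fin d) (c : ZMod L) (x : Site d L) :
    siteReflect i c x i = c + c - x i := by
  simp [siteReflect]

@[simp] theorem siteReflect_apply_ne (i : Fin d) (c : ZMod L) (x : Site d L) {k : Fin d} (h : k ≠ i) :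
    siteReflect i c x k = x k := by
  simp [siteReflect, h]

@[simp] theorem siteReflect_siteReflect (i : Fin d) (c : ZMod L) (x : Site d L) :
    siteReflect i c (siteReflect i c x) = x := by
  ext k
  by_cases h : k = i
  · subst h; simp
  · simp [h]

theorem siteReflect_shift_ne (i : Fin d) (c : ZMod L) (x : Site d L) {k : Fin d} (h : k ≠ i) :
    siteReflect i c (x.shift k) = (siteReflect i c x).shift k := by
  ext l
  by_cases hl : l = i
  · subst hl
    simp [Site.shift, Ne.symm h]
  · simp [Site.shift, hl]

theorem siteReflect_shift_self (i : Fin d) (c : ZMod L) (x : Site d L) :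
    siteReflect i c (x.shift i) = siteReflect i c x - Pi.single i 1 := by
  ext l
  by_cases hl : l = i
  · subst hl
    simp [Site.shift]; abel
  · simp [Site.shift, hl]

theorem siteReflect_sub_single (i : Fin d) (c : ZMod L) (x : Site d L) :
    siteReflect i c (x - Pi.single i 1) = siteReflect i c x + Pi.single i 1 := by
  ext l
  by_cases hl : l = i
  · subst hl
    simp; abel
  · simp [hl]

/-- `(θx - eᵢ).shift i = θ x`. -/
theorem sub_single_shift (i : Fin d) (y : Site d L) : (y - Pi.single i 1).shift i = y := by
  simp [Site.shift]

theorem sub_single_shift_ne (i : Fin d) (y : Site d L) {k : Fin d} (_h : k ≠ i) :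
    (y - Pi.single i 1).shift k = y.shift k - Pi.single i 1 := by
  simp [Site.shift]; abel

/-- The reflection on positively oriented links: a link in a direction `j ≠ i` goes to the link at the
reflected site; the link `x → x + eᵢ` goes to the link `θx - eᵢ → θx` (traversed backwards). -/
def edgeReflect (i : Fin d) (c : ZMod L) (e : Edge d L) : Edge d L :=
  if e.2 = i then (siteReflect i c e.1 - Pi.single i 1, i) else (siteReflect i c e.1, e.2)

theorem edgeReflect_edgeReflect (i : Fin d) (c : ZMod L) (e : Edge d L) :
    edgeReflect i c (edgeReflect i c e) = e := by
  obtain ⟨x, j⟩ := e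
  unfold edgeReflect
  by_cases h : j = i
  · subst h
    simp [siteReflect_sub_single]
  · simp [h]

/-- `edgeReflect` as a permutation of the links. -/
def edgeReflectEquiv (i : Fin d) (c : ZMod L) : Equiv.Perm (Edge d L) :=
  Function.Involutive.toPerm (edgeReflect i c) (edgeReflect_edgeReflect i c)

variable {G : Type*} [Group G]

/-- The reflection `Θ` on gauge configurations: relabel the links by `edgeReflect` and invert the
links in direction `i` (they are traversed backwards by the reflected plaquettes). -/
def configReflect (i : Fin d) (c : ZMod L) (U : GaugeConfig d L G) : GaugeConfig d L G :=
  fun e => if e.2 = i then (U (edgeReflect i c e))⁻¹ else U (edgeReflect i c e)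

theorem configReflect_apply_ne (i : Fin d) (c : ZMod L) (U : GaugeConfig d L G) (x : Site d L)
    {j : Fin d} (h : j ≠ i) : configReflect i c U (x, j) = U (siteReflect i c x, j) := by
  simp [configReflect, edgeReflect, h]

theorem configReflect_apply_self (i : Fin d) (c : ZMod L) (U : GaugeConfig d L G) (x : Site d L) :
    configReflect i c U (x, i) = (U (siteReflect i c x - Pi.single i 1, i))⁻¹ := by
  simp [configReflect, edgeReflect]

/-- The reflection on plaquettes: a plaquette in a plane not containing `eᵢ` goes to the plaquette at
the reflected base point; a plaquette in a plane containing `eᵢ` goes to the one based at `θx - eᵢ`. -/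
def plaqReflect (i : Fin d) (c : ZMod L) (p : Plaquette d L) : Plaquette d L :=
  (if p.2.1.1 = i ∨ p.2.1.2 = i then siteReflect i c p.1 - Pi.single i 1 else siteReflect i c p.1, p.2)

theorem plaqReflect_plaqReflect (i : Fin d) (c : ZMod L) (p : Plaquette d L) :
    plaqReflect i c (plaqReflect i c p) = p := by
  obtain ⟨x, jk⟩ := p
  unfold plaqReflect
  by_cases h : jk.1.1 = i ∨ jk.1.2 = i
  · simp [h, siteReflect_sub_single]
  · simp [h]

theorem plaqReflect_injective (i : Fin d) (c : ZMod L) : Function.Injective (plaqReflect i c) :=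
  (Function.Involutive.injective (plaqReflect_plaqReflect i c))

/-- Holonomy of a reflected configuration around a plaquette in a plane NOT containing `eᵢ`. -/
theorem plaquetteHolonomy_configReflect_of_ne (i : Fin d) (c : ZMod L) (U : GaugeConfig d L G)
    (x : Site d L) {j k : Fin d} (hj : j ≠ i) (hk : k ≠ i) :
    plaquetteHolonomy (configReflect i c U) x j k = plaquetteHolonomy U (siteReflect i c x) j k := by
  simp only [plaquetteHolonomy, configReflect_apply_ne _ _ _ _ hj, configReflect_apply_ne _ _ _ _ hk,
    siteReflect_shift_ne _ _ _ hj, siteReflect_shift_ne _ _ _ hk]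

/-- Holonomy of a reflected configuration around a plaquette `(x; i, k)`: the conjugate of the INVERSE
holonomy around the reflected plaquette. -/
theorem plaquetteHolonomy_configReflect_left (i : Fin d) (c : ZMod L) (U : GaugeConfig d L G)
    (x : Site d L) {k : Fin d} (hk : k ≠ i) :
    plaquetteHolonomy (configReflect i c U) x i k =
      (U (siteReflect i c x - Pi.single i 1, i))⁻¹ *
        (plaquetteHolonomy U (siteReflect i c x - Pi.single i 1) i k)⁻¹ *
        U (siteReflect i c x - Pi.single i 1, i) := by
  simp only [plaquetteHolonomy, configReflect_apply_ne _ _ _ _ hk, configReflect_apply_self,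
    siteReflect_shift_ne _ _ _ hk, siteReflect_shift_self, sub_single_shift, sub_single_shift_ne _ _ hk]
  group

/-- Holonomy of a reflected configuration around a plaquette `(x; j, i)`. -/
theorem plaquetteHolonomy_configReflect_right (i : Fin d) (c : ZMod L) (U : GaugeConfig d L G)
    (x : Site d L) {j : Fin d} (hj : j ≠ i) :
    plaquetteHolonomy (configReflect i c U) x j i =
      (U (siteReflect i c x - Pi.single i 1, i))⁻¹ *
        (plaquetteHolonomy U (siteReflect i c x - Pi.single i 1) j i)⁻¹ *
        U (siteReflect i c x - Pi.single i 1, i) := by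
  simp only [plaquetteHolonomy, configReflect_apply_ne _ _ _ _ hj, configReflect_apply_self,
    siteReflect_shift_ne _ _ _ hj, siteReflect_shift_self, sub_single_shift, sub_single_shift_ne _ _ hj]
  group

variable {N : ℕ} [TopologicalSpace G] [IsTopologicalGroup G] [CompactSpace G]
variable (ρ : G →* Matrix (Fin N) (Fin N) ℂ)

/-- `Re tr ρ(a⁻¹ g⁻¹ a) = Re tr ρ(g)` for a continuous representation of a compact group. -/
theorem re_trace_conj_inv (hρ : Continuous ρ) (a g : G) :
    ((ρ (a⁻¹ * g⁻¹ * a)).trace).re = ((ρ g).trace).re := by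
  have h := Literature.RepresentationTheory.CompactGroups.CompactGroup.trace_conj_eq ρ g⁻¹ a⁻¹
  rw [inv_inv] at h
  rw [h, Literature.RepresentationTheory.CompactGroups.CompactGroup.re_trace_map_inv ρ hρ]

/-- **Transport of the plaquette cost under the reflection**: `S_p(ΘU) = S_{θp}(U)` (characters of
compact groups are real on inverses and class functions). -/
theorem plaquetteCost_configReflect [NeZero L] (hρ : Continuous ρ) (i : Fin d) (c : ZMod L)
    (U : GaugeConfig d L G) (p : Plaquette d L) :
    plaquetteCost ρ (configReflect i c U) p = plaquetteCost ρ U (plaqReflect i c p) := by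
  obtain ⟨x, ⟨⟨j, k⟩, hjk⟩⟩ := p
  unfold plaquetteCost plaqReflect
  simp only
  by_cases hj : j = i
  · subst hj
    have hk : k ≠ j := fun h => by simp [h] at hjk
    rw [if_pos (Or.inl rfl), plaquetteHolonomy_configReflect_left _ _ _ _ hk, re_trace_conj_inv ρ hρ]
  · by_cases hk : k = i
    · subst hk
      rw [if_pos (Or.inr rfl), plaquetteHolonomy_configReflect_right _ _ _ _ hj, re_trace_conj_inv ρ hρ]
    · rw [if_neg (by tauto), plaquetteHolonomy_configReflect_of_ne _ _ _ _ hj hk]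

end TorusGeometry

/-! ## §2 Heights above the reflection plane; the positive links `P` and the in-plane links `M` -/

section TorusRP

variable {d L : ℕ} [NeZero L]

/-- The height of a site above the lattice hyperplane `x_i = c`, read in `[0, L)`. -/
def ht (i : Fin d) (c : ZMod L) (x : Site d L) : ℕ := (x i - c).val

omit [NeZero L] in
theorem ht_eq_zero_iff (i : Fin d) (c : ZMod L) (x : Site d L) : ht i c x = 0 ↔ x i = c := by
  rw [ht, ZMod.val_eq_zero, sub_eq_zero]

theorem ht_lt (i : Fin d) (c : ZMod L) (x : Site d L) : ht i c x < L := ZMod.val_lt _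

omit [NeZero L] in
theorem ht_shift_ne (i : Fin d) (c : ZMod L) (x : Site d L) {k : Fin d} (h : k ≠ i) :
    ht i c (x.shift k) = ht i c x := by
  simp [ht, Site.shift, Ne.symm h]

theorem ht_shift_self (i : Fin d) (c : ZMod L) (x : Site d L) (hx : ht i c x + 1 < L) :
    ht i c (x.shift i) = ht i c x + 1 := by
  haveI : Fact (1 < L) := ⟨by omega⟩
  have h1 : (x.shift i) i - c = (x i - c) + 1 := by simp [Site.shift]; abel
  unfold ht at hx ⊢
  rw [h1, ZMod.val_add, ZMod.val_one, Nat.mod_eq_of_lt hx]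

theorem ht_siteReflect (i : Fin d) (c : ZMod L) (x : Site d L) (hx : ht i c x ≠ 0) :
    ht i c (siteReflect i c x) = L - ht i c x := by
  have h1 : siteReflect i c x i - c = -(x i - c) := by simp; abel
  have hx' : x i - c ≠ 0 := fun h => hx (by rw [ht, h, ZMod.val_zero])
  unfold ht
  rw [h1, ZMod.neg_val, if_neg hx']

theorem ht_siteReflect_sub_single (i : Fin d) (c : ZMod L) (x : Site d L) (hx : ht i c x + 1 < L) :
    ht i c (siteReflect i c x - Pi.single i 1) = L - (ht i c x + 1) := by
  haveI : Fact (1 < L) := ⟨by omega⟩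
  have h1 : (siteReflect i c x - Pi.single i 1 : Site d L) i - c = -((x i - c) + 1) := by simp; abel
  have hv : ((x i - c) + 1 : ZMod L).val = ht i c x + 1 := by
    unfold ht at hx ⊢; rw [ZMod.val_add, ZMod.val_one, Nat.mod_eq_of_lt hx]
  have hne : ((x i - c) + 1 : ZMod L) ≠ 0 := fun h => by
    rw [h, ZMod.val_zero] at hv; omega
  show ((siteReflect i c x - Pi.single i 1 : Site d L) i - c).val = L - (ht i c x + 1)
  rw [h1, ZMod.neg_val, if_neg hne, hv]

omit [NeZero L] in
theorem siteReflect_eq_self_of_ht (i : Fin d) (c : ZMod L) (x : Site d L) (hx : ht i c x = 0) :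
    siteReflect i c x = x := by
  rw [ht_eq_zero_iff] at hx
  ext k
  by_cases h : k = i
  · subst h; simp [hx]
  · simp [h]

/-- The POSITIVE links: links in directions `≠ i` at heights `1 … H`, and links in direction `i`
starting at heights `0 … H-1`. -/
def posEdges (i : Fin d) (c : ZMod L) (H : ℕ) : Finset (Edge d L) :=
  univ.filter fun e => (e.2 ≠ i ∧ 1 ≤ ht i c e.1 ∧ ht i c e.1 ≤ H) ∨ (e.2 = i ∧ ht i c e.1 + 1 ≤ H)

/-- The IN-PLANE links: links in directions `≠ i` at height `0` (fixed by the reflection). -/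
def planeEdges (i : Fin d) (c : ZMod L) : Finset (Edge d L) :=
  univ.filter fun e => e.2 ≠ i ∧ ht i c e.1 = 0

theorem mem_posEdges {i : Fin d} {c : ZMod L} {H : ℕ} {e : Edge d L} :
    e ∈ posEdges i c H ↔ (e.2 ≠ i ∧ 1 ≤ ht i c e.1 ∧ ht i c e.1 ≤ H) ∨ (e.2 = i ∧ ht i c e.1 + 1 ≤ H) := by
  simp [posEdges]

theorem mem_planeEdges {i : Fin d} {c : ZMod L} {e : Edge d L} :
    e ∈ planeEdges i c ↔ e.2 ≠ i ∧ ht i c e.1 = 0 := by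
  simp [planeEdges]

theorem disjoint_planeEdges_posEdges (i : Fin d) (c : ZMod L) (H : ℕ) :
    Disjoint (planeEdges i c) (posEdges i c H) := by
  rw [Finset.disjoint_left]
  intro e he hp
  rw [mem_planeEdges] at he
  rw [mem_posEdges] at hp
  omega

/-- The reflection of a positive link is not positive (it lies strictly below the plane). -/
theorem edgeReflect_not_mem_posEdges {i : Fin d} {c : ZMod L} {H : ℕ} (hH : 2 * H < L) {e : Edge d L}
    (he : e ∈ posEdges i c H) : edgeReflect i c e ∉ posEdges i c H := by
  obtain ⟨x, j⟩ := e
  rw [mem_posEdges] at he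
  intro hmem
  rw [mem_posEdges] at hmem
  unfold edgeReflect at hmem
  by_cases hj : j = i
  · subst hj
    simp only [if_true] at hmem
    have ht0 : ht j c x + 1 ≤ H := by
      rcases he with h | h
      · exact absurd rfl h.1
      · exact h.2
    rw [ht_siteReflect_sub_single j c x (by omega)] at hmem
    omega
  · simp only [hj, if_false] at hmem
    have ht0 : 1 ≤ ht i c x ∧ ht i c x ≤ H := by
      rcases he with h | h
      · exact h.2
      · exact absurd h.1 hj
    rw [ht_siteReflect i c x (by omega)] at hmem
    omega

variable {G : Type*} [Group G]

/-- `Θ` fixes the in-plane links. -/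
theorem configReflect_apply_of_mem_planeEdges (i : Fin d) (c : ZMod L) (U : GaugeConfig d L G)
    {e : Edge d L} (he : e ∈ planeEdges i c) : configReflect i c U e = U e := by
  obtain ⟨x, j⟩ := e
  rw [mem_planeEdges] at he
  rw [configReflect_apply_ne _ _ _ _ he.1, siteReflect_eq_self_of_ht _ _ _ he.2]

/-- The positive coordinates of `Θ U` depend only on the coordinates of `U` off `P`. -/
theorem dependsOn_configReflect {i : Fin d} {c : ZMod L} {H : ℕ} (hH : 2 * H < L) {e : Edge d L}
    (he : e ∈ posEdges i c H ∪ ∅) :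
    DependsOn (fun U : GaugeConfig d L G => configReflect i c U e) (((posEdges i c H)ᶜ : Finset (Edge d L)) : Set (Edge d L)) := by
  rw [Finset.union_empty] at he
  have hmem : edgeReflect i c e ∈ (((posEdges i c H)ᶜ : Finset (Edge d L)) : Set (Edge d L)) :=
    Finset.mem_coe.2 (Finset.mem_compl.2 (edgeReflect_not_mem_posEdges hH he))
  intro U V hUV
  simp only [configReflect]
  rw [hUV _ hmem]

variable [MeasurableSpace G] [TopologicalSpace G] [IsTopologicalGroup G] [CompactSpace G] [BorelSpace G]

/-- **`Θ` preserves the product Haar measure** (relabelling of the links by an involution and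
inversion of the links in direction `i`; Haar measure is inversion invariant). -/
theorem measurePreserving_configReflect (i : Fin d) (c : ZMod L) :
    MeasurePreserving (configReflect i c : GaugeConfig d L G → GaugeConfig d L G)
      (LatticeRP.piMeasure (haarProbability G)) (LatticeRP.piMeasure (haarProbability G)) := by
  have h1 : MeasurePreserving
      (MeasurableEquiv.arrowCongr' (edgeReflectEquiv (d := d) (L := L) i c) (MeasurableEquiv.refl G))
      (LatticeRP.piMeasure (haarProbability G)) (LatticeRP.piMeasure (haarProbability G)) :=
    measurePreserving_arrowCongr' (fun _ => haarProbability G) (fun _ => haarProbability G)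
      (edgeReflectEquiv i c) (MeasurableEquiv.refl G) fun _ => MeasurePreserving.id _
  have h2 : MeasurePreserving
      (fun (V : GaugeConfig d L G) (e : Edge d L) =>
        (if e.2 = i then (fun g : G => g⁻¹) else id) (V e))
      (LatticeRP.piMeasure (haarProbability G)) (LatticeRP.piMeasure (haarProbability G)) := by
    refine measurePreserving_pi _ _ fun e => ?_
    split_ifs
    · exact Measure.measurePreserving_inv _
    · exact MeasurePreserving.id _
  have heq : (configReflect i c : GaugeConfig d L G → GaugeConfig d L G) =
      (fun (V : GaugeConfig d L G) (e : Edge d L) =>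
        (if e.2 = i then (fun g : G => g⁻¹) else id) (V e)) ∘
      (MeasurableEquiv.arrowCongr' (edgeReflectEquiv (d := d) (L := L) i c) (MeasurableEquiv.refl G)) := by
    funext U e
    have happ : (MeasurableEquiv.arrowCongr' (edgeReflectEquiv (d := d) (L := L) i c)
        (MeasurableEquiv.refl G)) U e = U (edgeReflect i c e) := rfl
    simp only [Function.comp_apply, configReflect, happ]
    split_ifs <;> rfl
  rw [heq]
  exact h2.comp h1

end TorusRP

/-! ## §3 The half-weighted Boltzmann factor and the doubling inequality on the torus -/

section TorusDoubling

open scoped Classical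

variable {d L : ℕ} [NeZero L]

/-- The plaquette lies in a plane containing the direction `i`. -/
def Touches (i : Fin d) (p : Plaquette d L) : Prop := p.2.1.1 = i ∨ p.2.1.2 = i

/-- UPPER plaquettes of range `H`: all links at heights `0 … H` (positive or in-plane). -/
def IsUpper (i : Fin d) (c : ZMod L) (H : ℕ) (p : Plaquette d L) : Prop :=
  (¬ Touches i p ∧ ht i c p.1 ≤ H) ∨ (Touches i p ∧ ht i c p.1 + 1 ≤ H)

/-- FACE plaquettes: those lying in the reflection plane (fixed by the reflection). -/
def IsFace (i : Fin d) (c : ZMod L) (p : Plaquette d L) : Prop := ¬ Touches i p ∧ ht i c p.1 = 0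

omit [NeZero L] in
theorem plaqReflect_of_isFace {i : Fin d} {c : ZMod L} {p : Plaquette d L} (hp : IsFace i c p) :
    plaqReflect i c p = p := by
  obtain ⟨x, jk⟩ := p
  obtain ⟨hnt, h0⟩ := hp
  unfold plaqReflect
  rw [if_neg (by exact hnt), siteReflect_eq_self_of_ht _ _ _ h0]

/-- The reflection of an upper non-face plaquette is not upper (it lies strictly below the plane). -/
theorem not_isUpper_plaqReflect {i : Fin d} {c : ZMod L} {H : ℕ} (hH : 2 * H < L) {p : Plaquette d L}
    (hp : IsUpper i c H p) (hnf : ¬ IsFace i c p) : ¬ IsUpper i c H (plaqReflect i c p) := by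
  obtain ⟨x, jk⟩ := p
  unfold IsUpper IsFace Touches plaqReflect at *
  simp only at hp hnf ⊢
  by_cases ht0 : jk.1.1 = i ∨ jk.1.2 = i
  · rw [if_pos ht0]
    have h1 : ht i c x + 1 ≤ H := by tauto
    rw [ht_siteReflect_sub_single i c x (by omega)]
    omega
  · rw [if_neg ht0]
    have h1 : ht i c x ≤ H := by tauto
    have h2 : ht i c x ≠ 0 := by tauto
    rw [ht_siteReflect i c x h2]
    omega

variable {G : Type*} [Group G]

theorem mem_PM_of_ne {i : Fin d} {c : ZMod L} {H : ℕ} {y : Site d L} {j : Fin d} (hj : j ≠ i)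
    (hy : ht i c y ≤ H) : (y, j) ∈ posEdges i c H ∪ planeEdges i c := by
  rw [Finset.mem_union, mem_posEdges, mem_planeEdges]
  rcases Nat.eq_zero_or_pos (ht i c y) with h0 | h0
  · exact Or.inr ⟨hj, h0⟩
  · exact Or.inl (Or.inl ⟨hj, h0, hy⟩)

theorem mem_PM_of_eq {i : Fin d} {c : ZMod L} {H : ℕ} {y : Site d L} (hy : ht i c y + 1 ≤ H) :
    (y, i) ∈ posEdges i c H ∪ planeEdges i c := by
  rw [Finset.mem_union, mem_posEdges]
  exact Or.inl (Or.inr ⟨rfl, hy⟩)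

/-- The holonomy of an upper plaquette depends only on the positive and in-plane links. -/
theorem plaquetteHolonomy_eq_of_isUpper {i : Fin d} {c : ZMod L} {H : ℕ} (hH : 2 * H < L)
    {p : Plaquette d L} (hp : IsUpper i c H p) {U V : GaugeConfig d L G}
    (hUV : ∀ e ∈ ((posEdges i c H ∪ ∅ ∪ planeEdges i c : Finset (Edge d L)) : Set (Edge d L)), U e = V e) :
    plaquetteHolonomy U p.1 p.2.1.1 p.2.1.2 = plaquetteHolonomy V p.1 p.2.1.1 p.2.1.2 := by
  rw [Finset.union_empty] at hUV
  have hUV' : ∀ e ∈ posEdges i c H ∪ planeEdges i c, U e = V e := fun e he => hUV e (Finset.mem_coe.2 he)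
  obtain ⟨x, ⟨⟨j, k⟩, hjk⟩⟩ := p
  unfold IsUpper Touches at hp
  simp only at hp ⊢
  simp only [plaquetteHolonomy]
  by_cases hj : j = i
  · subst hj
    have hk : k ≠ j := fun h => by simp [h] at hjk
    have h1 : ht j c x + 1 ≤ H := by tauto
    rw [hUV' _ (mem_PM_of_eq h1),
      hUV' _ (mem_PM_of_ne hk (by rw [ht_shift_self j c x (by omega)]; exact h1)),
      hUV' _ (mem_PM_of_eq (by rw [ht_shift_ne j c x hk]; exact h1)),
      hUV' _ (mem_PM_of_ne hk (by omega))]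
  · by_cases hk : k = i
    · subst hk
      have h1 : ht k c x + 1 ≤ H := by tauto
      rw [hUV' _ (mem_PM_of_ne hj (by omega)),
        hUV' _ (mem_PM_of_eq (by rw [ht_shift_ne k c x hj]; exact h1)),
        hUV' _ (mem_PM_of_ne hj (by rw [ht_shift_self k c x (by omega)]; exact h1)),
        hUV' _ (mem_PM_of_eq h1)]
    · have h1 : ht i c x ≤ H := by tauto
      rw [hUV' _ (mem_PM_of_ne hj h1),
        hUV' _ (mem_PM_of_ne hk (by rw [ht_shift_ne i c x hj]; exact h1)),
        hUV' _ (mem_PM_of_ne hj (by rw [ht_shift_ne i c x hk]; exact h1)),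
        hUV' _ (mem_PM_of_ne hk h1)]

variable {N : ℕ} [TopologicalSpace G] [IsTopologicalGroup G] [CompactSpace G] [MeasurableSpace G] [BorelSpace G]
variable (ρ : G →* Matrix (Fin N) (Fin N) ℂ) (β : ℝ)

/-- The torus Boltzmann weight of one plaquette. -/
def tw (p : Plaquette d L) (U : GaugeConfig d L G) : ℝ := Real.exp (-β * plaquetteCost ρ U p)

/-- The HALF-WEIGHTED Boltzmann factor of a set of plaquettes: face plaquettes carry `w_p^{1/2}`. -/
def halfWeight (i : Fin d) (c : ZMod L) (A : Finset (Plaquette d L)) (U : GaugeConfig d L G) : ℝ :=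
  ∏ p ∈ A, if IsFace i c p then Real.sqrt (tw ρ β p U) else tw ρ β p U

omit [NeZero L] [TopologicalSpace G] [IsTopologicalGroup G] [CompactSpace G] [MeasurableSpace G] [BorelSpace G] in
theorem tw_pos [NeZero L] (p : Plaquette d L) (U : GaugeConfig d L G) : 0 < tw ρ β p U := Real.exp_pos _

omit [NeZero L] [TopologicalSpace G] [IsTopologicalGroup G] [CompactSpace G] [MeasurableSpace G] [BorelSpace G] in
theorem tw_le_one [NeZero L] (hρN : ∀ g, (ρ g).trace.re ≤ N) (hβ : 0 ≤ β) (p : Plaquette d L) (U : GaugeConfig d L G) :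
    tw ρ β p U ≤ 1 := by
  unfold tw
  rw [Real.exp_le_one_iff]
  have : 0 ≤ plaquetteCost ρ U p := by
    unfold plaquetteCost; linarith [hρN (plaquetteHolonomy U p.1 p.2.1.1 p.2.1.2)]
  nlinarith

omit [NeZero L] [CompactSpace G] [MeasurableSpace G] [BorelSpace G] in
theorem continuous_tw [NeZero L] (hρ : Continuous ρ) (p : Plaquette d L) :
    Continuous fun U : GaugeConfig d L G => tw ρ β p U := by
  unfold tw plaquetteCost
  have h1 : Continuous fun U : GaugeConfig d L G => plaquetteHolonomy U p.1 p.2.1.1 p.2.1.2 := by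
    unfold plaquetteHolonomy; fun_prop
  have h2 : Continuous fun U : GaugeConfig d L G =>
      (ρ (plaquetteHolonomy U p.1 p.2.1.1 p.2.1.2)).trace.re :=
    Complex.continuous_re.comp (hρ.comp h1).matrix_trace
  exact Real.continuous_exp.comp (continuous_const.mul (continuous_const.sub h2))

omit [CompactSpace G] [MeasurableSpace G] [BorelSpace G] in
theorem continuous_prod_tw (hρ : Continuous ρ) (A : Finset (Plaquette d L)) :
    Continuous fun U : GaugeConfig d L G => ∏ p ∈ A, tw ρ β p U :=
  continuous_finsetProd _ fun p _ => continuous_tw ρ β hρ p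

omit [CompactSpace G] [MeasurableSpace G] [BorelSpace G] in
theorem continuous_halfWeight (hρ : Continuous ρ) (i : Fin d) (c : ZMod L) (A : Finset (Plaquette d L)) :
    Continuous fun U : GaugeConfig d L G => halfWeight ρ β i c A U := by
  unfold halfWeight
  refine continuous_finsetProd _ fun p _ => ?_
  by_cases hf : IsFace i c p
  · simp only [hf, if_true]; exact (continuous_tw ρ β hρ p).sqrt
  · simp only [hf, if_false]; exact continuous_tw ρ β hρ p

omit [TopologicalSpace G] [IsTopologicalGroup G] [CompactSpace G] [MeasurableSpace G] [BorelSpace G] in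
theorem halfWeight_nonneg (i : Fin d) (c : ZMod L) (A : Finset (Plaquette d L)) (U : GaugeConfig d L G) :
    0 ≤ halfWeight ρ β i c A U := by
  unfold halfWeight
  refine prod_nonneg fun p _ => ?_
  by_cases hf : IsFace i c p
  · rw [if_pos hf]; exact Real.sqrt_nonneg _
  · rw [if_neg hf]; exact (tw_pos ρ β p U).le

omit [TopologicalSpace G] [IsTopologicalGroup G] [CompactSpace G] [MeasurableSpace G] [BorelSpace G] in
theorem halfWeight_le_one (hρN : ∀ g, (ρ g).trace.re ≤ N) (hβ : 0 ≤ β) (i : Fin d) (c : ZMod L)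
    (A : Finset (Plaquette d L)) (U : GaugeConfig d L G) : halfWeight ρ β i c A U ≤ 1 := by
  unfold halfWeight
  refine prod_le_one (fun p _ => ?_) (fun p _ => ?_)
  · by_cases hf : IsFace i c p
    · rw [if_pos hf]; exact Real.sqrt_nonneg _
    · rw [if_neg hf]; exact (tw_pos ρ β p U).le
  · by_cases hf : IsFace i c p
    · rw [if_pos hf]; exact (Real.sqrt_le_sqrt (tw_le_one ρ β hρN hβ p U)).trans_eq Real.sqrt_one
    · rw [if_neg hf]; exact tw_le_one ρ β hρN hβ p U

omit [TopologicalSpace G] [IsTopologicalGroup G] [CompactSpace G] [MeasurableSpace G] [BorelSpace G] in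
/-- `∏_{p ∈ A} w_p ≤ halfWeight` (`w ≤ √w` on `[0, 1]`). -/
theorem prod_tw_le_halfWeight (hρN : ∀ g, (ρ g).trace.re ≤ N) (hβ : 0 ≤ β) (i : Fin d) (c : ZMod L)
    (A : Finset (Plaquette d L)) (U : GaugeConfig d L G) :
    ∏ p ∈ A, tw ρ β p U ≤ halfWeight ρ β i c A U := by
  unfold halfWeight
  refine prod_le_prod (fun p _ => (tw_pos ρ β p U).le) fun p _ => ?_
  by_cases hf : IsFace i c p
  · rw [if_pos hf]
    calc tw ρ β p U = Real.sqrt ((tw ρ β p U) ^ 2) := (Real.sqrt_sq (tw_pos ρ β p U).le).symm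
      _ ≤ Real.sqrt (tw ρ β p U) :=
          Real.sqrt_le_sqrt (by nlinarith [tw_pos ρ β p U, tw_le_one ρ β hρN hβ p U])
  · rw [if_neg hf]

omit [MeasurableSpace G] [BorelSpace G] in
/-- The weight of a reflected configuration is the weight of the reflected plaquette. -/
theorem tw_configReflect (hρ : Continuous ρ) (i : Fin d) (c : ZMod L) (p : Plaquette d L) (U : GaugeConfig d L G) :
    tw ρ β p (configReflect i c U) = tw ρ β (plaqReflect i c p) U := by
  unfold tw; rw [plaquetteCost_configReflect ρ hρ]

omit [MeasurableSpace G] [BorelSpace G] in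
/-- **`F · (F ∘ Θ)` is the full Boltzmann weight of the doubled set** `A ∪ θ(A ∖ faces)`. -/
theorem halfWeight_mul_halfWeight_configReflect (hρ : Continuous ρ) {i : Fin d} {c : ZMod L} {H : ℕ}
    (hH : 2 * H < L) {A : Finset (Plaquette d L)} (hA : ∀ p ∈ A, IsUpper i c H p) (U : GaugeConfig d L G) :
    halfWeight ρ β i c A U * halfWeight ρ β i c A (configReflect i c U) =
      ∏ p ∈ A ∪ (A.filter fun p => ¬ IsFace i c p).image (plaqReflect i c), tw ρ β p U := by
  have hdisj : Disjoint A ((A.filter fun p => ¬ IsFace i c p).image (plaqReflect i c)) := by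
    rw [Finset.disjoint_left]
    intro q hq hq'
    obtain ⟨p, hp, rfl⟩ := Finset.mem_image.1 hq'
    rw [Finset.mem_filter] at hp
    exact not_isUpper_plaqReflect hH (hA p hp.1) hp.2 (hA _ hq)
  rw [prod_union hdisj, prod_image fun p _ q _ h => plaqReflect_injective i c h, prod_filter,
    halfWeight, halfWeight, ← prod_mul_distrib, ← prod_mul_distrib]
  refine prod_congr rfl fun p _ => ?_
  by_cases hf : IsFace i c p
  · simp only [hf, not_true_eq_false, if_true, if_false, tw_configReflect ρ β hρ, plaqReflect_of_isFace hf,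
      mul_one]
    exact Real.mul_self_sqrt (tw_pos ρ β p U).le
  · simp only [hf, not_false_eq_true, if_true, if_false, tw_configReflect ρ β hρ]

variable [SecondCountableTopology G]

omit [NeZero L] in
theorem splice_empty {ι X : Type*} [DecidableEq ι] (p : (ι → X) × (ι → X)) :
    LatticeRP.splice (∅ : Finset ι) p = p.1 := by
  funext j; simp [LatticeRP.splice_apply]

/-- **Reflection positivity through sites, Schwarz form**: `(∫ F)² ≤ ∫ F · (F ∘ Θ)` for the
half-weighted Boltzmann factor of a set of upper plaquettes. -/
theorem sq_integral_halfWeight_le (hρ : Continuous ρ) (hρN : ∀ g, (ρ g).trace.re ≤ N) (hβ : 0 ≤ β)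
    {i : Fin d} {c : ZMod L} {H : ℕ} (hH : 2 * H < L) {A : Finset (Plaquette d L)}
    (hA : ∀ p ∈ A, IsUpper i c H p) :
    (∫ U, halfWeight ρ β i c A U ∂(LatticeRP.piMeasure (haarProbability G))) ^ 2 ≤
      ∫ U, halfWeight ρ β i c A U * halfWeight ρ β i c A (configReflect i c U)
        ∂(LatticeRP.piMeasure (haarProbability G)) := by
  set μ : Measure (GaugeConfig d L G) := LatticeRP.piMeasure (haarProbability G) with hμ
  set Φ : GaugeConfig d L G → ℂ := fun U => (halfWeight ρ β i c A U : ℂ) with hΦ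
  have hΦm : Measurable Φ := (Complex.continuous_ofReal.comp (continuous_halfWeight ρ β hρ i c A)).measurable
  have hΦb : ∀ U, ‖Φ U‖ ≤ 1 := fun U => by
    rw [hΦ]; dsimp only
    rw [Complex.norm_real, Real.norm_of_nonneg (halfWeight_nonneg ρ β i c A U)]
    exact halfWeight_le_one ρ β hρN hβ i c A U
  have hΦdep : DependsOn Φ ((posEdges i c H ∪ ∅ ∪ planeEdges i c : Finset (Edge d L)) : Set (Edge d L)) := by
    intro U V hUV
    rw [hΦ]; dsimp only
    congr 1
    unfold halfWeight
    refine prod_congr rfl fun p hp => ?_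
    have h := plaquetteHolonomy_eq_of_isUpper (G := G) hH (hA p hp) hUV
    simp only [tw, plaquetteCost, h]
  have key := (LatticeRP.re_sum_pair_sq_le (haarProbability G) (∅ : Finset (Edge d L)) (configReflect i c)
    (I := Empty) (fun _ _ => (0 : ℂ)) (planeEdges i c) (posEdges i c H)
    (measurePreserving_configReflect i c) (fun U e he => configReflect_apply_of_mem_planeEdges i c U he)
    (fun e he => dependsOn_configReflect hH he) (disjoint_planeEdges_posEdges i c H)
    (Finset.disjoint_empty_right _) (fun _ => measurable_const) (Ka := 0) (fun _ _ => by simp)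
    (fun k => Empty.elim k) (κ := Unit) (Φ := fun _ => Φ) (Ψ := fun _ _ => (1 : ℂ))
    (fun _ => hΦm) (fun _ => measurable_const) (KΦ := 1) (KΨ := 1) (fun _ U => hΦb U)
    (fun _ _ => by simp) (fun _ => hΦdep) (fun _ _ _ _ => rfl)).2
  simp only [splice_empty, Finset.univ_unique, Finset.sum_singleton, Finset.univ_eq_empty,
    Finset.sum_empty, Complex.exp_zero, mul_one, map_one] at key
  rw [integral_fun_fst (fun U => Φ U), integral_fun_fst (fun U => Φ U * conj (Φ (configReflect i c U))),
    integral_const] at key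
  simp only [probReal_univ, one_smul, Complex.one_re, mul_one] at key
  have e1 : (∫ U, Φ U ∂μ) = ((∫ U, halfWeight ρ β i c A U ∂μ : ℝ) : ℂ) := by
    rw [hΦ]; exact integral_complex_ofReal
  have e2 : (∫ U, Φ U * conj (Φ (configReflect i c U)) ∂μ) =
      ((∫ U, halfWeight ρ β i c A U * halfWeight ρ β i c A (configReflect i c U) ∂μ : ℝ) : ℂ) := by
    rw [hΦ]; dsimp only
    simp_rw [Complex.conj_ofReal, ← Complex.ofReal_mul]
    exact integral_complex_ofReal
  rw [e1, e2, Complex.ofReal_re, Complex.ofReal_re] at key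
  exact key

/-- **The doubling inequality on the torus**: for a set `A` of upper plaquettes,
`(∫ ∏_{A} w)² ≤ ∫ ∏_{A ∪ θ(A ∖ faces)} w` (product Haar measure, `β ≥ 0`). -/
theorem sq_integral_prod_tw_le (hρ : Continuous ρ) (hρN : ∀ g, (ρ g).trace.re ≤ N) (hβ : 0 ≤ β)
    {i : Fin d} {c : ZMod L} {H : ℕ} (hH : 2 * H < L) {A : Finset (Plaquette d L)}
    (hA : ∀ p ∈ A, IsUpper i c H p) :
    (∫ U, ∏ p ∈ A, tw ρ β p U ∂(Measure.pi fun _ : Edge d L => haarProbability G)) ^ 2 ≤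
      ∫ U, ∏ p ∈ A ∪ (A.filter fun p => ¬ IsFace i c p).image (plaqReflect i c), tw ρ β p U
        ∂(Measure.pi fun _ : Edge d L => haarProbability G) := by
  have h1 : (∫ U, ∏ p ∈ A, tw ρ β p U ∂(Measure.pi fun _ : Edge d L => haarProbability G)) ≤
      ∫ U, halfWeight ρ β i c A U ∂(Measure.pi fun _ : Edge d L => haarProbability G) :=
    integral_mono ((continuous_prod_tw ρ β hρ A).integrable_of_hasCompactSupport (HasCompactSupport.of_compactSpace _))
      ((continuous_halfWeight ρ β hρ i c A).integrable_of_hasCompactSupport (HasCompactSupport.of_compactSpace _))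
      fun U => prod_tw_le_halfWeight ρ β hρN hβ i c A U
  have h0 : 0 ≤ ∫ U, ∏ p ∈ A, tw ρ β p U ∂(Measure.pi fun _ : Edge d L => haarProbability G) :=
    integral_nonneg fun U => prod_nonneg fun p _ => (tw_pos ρ β p U).le
  have h2 := sq_integral_halfWeight_le ρ β hρ hρN hβ hH hA
  simp_rw [halfWeight_mul_halfWeight_configReflect ρ β hρ hH hA] at h2
  calc (∫ U, ∏ p ∈ A, tw ρ β p U ∂(Measure.pi fun _ : Edge d L => haarProbability G)) ^ 2
      ≤ (∫ U, halfWeight ρ β i c A U ∂(Measure.pi fun _ : Edge d L => haarProbability G)) ^ 2 :=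
        pow_le_pow_left₀ h0 h1 2
    _ ≤ _ := h2

end TorusDoubling

/-! ## §4 Transfer to `ℤ^d`: the doubling inequality for free-boundary partition functions -/

section Zd

open scoped Classical
open Literature.Probability.LatticeModels (halfOpenBox Torus.proj)

variable {d : ℕ}

/-- Reflection of `ℤ^d` in the lattice hyperplane `x_i = c₀`. -/
def zReflect (i : Fin d) (c₀ : ℤ) (x : Fin d → ℤ) : Fin d → ℤ := Function.update x i (c₀ + c₀ - x i)

/-- The plaquette lies in a plane containing `eᵢ`. -/
def ZTouches (i : Fin d) (p : ZdPlaquette d) : Prop := p.2.1.1 = i ∨ p.2.1.2 = i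

/-- Reflection of plaquettes of `ℤ^d` in the hyperplane `x_i = c₀`. -/
def zPlaqReflect (i : Fin d) (c₀ : ℤ) (p : ZdPlaquette d) : ZdPlaquette d :=
  (if ZTouches i p then zReflect i c₀ p.1 - Pi.single i 1 else zReflect i c₀ p.1, p.2)

/-- Upper plaquettes of range `H` above the hyperplane `x_i = c₀`. -/
def ZIsUpper (i : Fin d) (c₀ : ℤ) (H : ℕ) (p : ZdPlaquette d) : Prop :=
  (¬ ZTouches i p ∧ c₀ ≤ p.1 i ∧ p.1 i ≤ c₀ + H) ∨ (ZTouches i p ∧ c₀ ≤ p.1 i ∧ p.1 i + 1 ≤ c₀ + H)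

/-- Face plaquettes: those inside the hyperplane `x_i = c₀`. -/
def ZIsFace (i : Fin d) (c₀ : ℤ) (p : ZdPlaquette d) : Prop := ¬ ZTouches i p ∧ p.1 i = c₀

/-- The DOUBLED set `A ∪ θ(A ∖ faces)`. -/
def zDouble (i : Fin d) (c₀ : ℤ) (I : Finset (ZdPlaquette d)) : Finset (ZdPlaquette d) :=
  I ∪ (I.filter fun p => ¬ ZIsFace i c₀ p).image (zPlaqReflect i c₀)

/-- The torus plaquette below a plaquette of `ℤ^d`. -/
def toT (L : ℕ) (p : ZdPlaquette d) : Plaquette d L := (Torus.proj L p.1, p.2)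

theorem proj_zReflect (L : ℕ) (i : Fin d) (c₀ : ℤ) (x : Fin d → ℤ) :
    Torus.proj L (zReflect i c₀ x) = siteReflect i (c₀ : ZMod L) (Torus.proj L x) := by
  ext k
  by_cases hk : k = i
  · subst hk; simp [Torus.proj, zReflect]
  · simp [Torus.proj, zReflect, hk]

theorem proj_sub_single (L : ℕ) (i : Fin d) (x : Fin d → ℤ) :
    Torus.proj L (x - Pi.single i 1) = Torus.proj L x - Pi.single i 1 := by
  ext k
  by_cases hk : k = i
  · subst hk; simp [Torus.proj]
  · simp [Torus.proj, hk]

theorem toT_zPlaqReflect (L : ℕ) (i : Fin d) (c₀ : ℤ) (p : ZdPlaquette d) :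
    toT L (zPlaqReflect i c₀ p) = plaqReflect i (c₀ : ZMod L) (toT L p) := by
  unfold toT zPlaqReflect plaqReflect ZTouches
  by_cases h : p.2.1.1 = i ∨ p.2.1.2 = i
  · rw [if_pos h, if_pos h, proj_sub_single, proj_zReflect]
  · rw [if_neg h, if_neg h, proj_zReflect]

theorem ht_toT (L : ℕ) [NeZero L] (i : Fin d) (c₀ : ℤ) (x : Fin d → ℤ) (h0 : c₀ ≤ x i) (hL : x i < c₀ + L) :
    ((ht i (c₀ : ZMod L) (Torus.proj L x) : ℕ) : ℤ) = x i - c₀ := by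
  unfold ht
  have : (Torus.proj L x) i - (c₀ : ZMod L) = ((x i - c₀ : ℤ) : ZMod L) := by simp [Torus.proj]
  rw [this, ZMod.val_intCast]
  exact Int.emod_eq_of_lt (by omega) (by omega)

theorem isUpper_toT {L : ℕ} [NeZero L] {i : Fin d} {c₀ : ℤ} {H : ℕ} (hHL : H < L) {p : ZdPlaquette d}
    (hp : ZIsUpper i c₀ H p) : IsUpper i (c₀ : ZMod L) H (toT L p) := by
  have hT : Touches i (toT L p) ↔ ZTouches i p := Iff.rfl
  unfold IsUpper
  rw [hT]
  unfold ZIsUpper at hp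
  have hx : c₀ ≤ p.1 i ∧ p.1 i < c₀ + L := by rcases hp with h | h <;> constructor <;> omega
  have hh := ht_toT L i c₀ p.1 hx.1 hx.2
  change ((ht i (c₀ : ZMod L) (toT L p).1 : ℕ) : ℤ) = p.1 i - c₀ at hh
  rcases hp with h | h
  · left; exact ⟨h.1, by omega⟩
  · right; exact ⟨h.1, by omega⟩

theorem isFace_toT_iff {L : ℕ} [NeZero L] {i : Fin d} {c₀ : ℤ} {H : ℕ} (hHL : H < L) {p : ZdPlaquette d}
    (hp : ZIsUpper i c₀ H p) : IsFace i (c₀ : ZMod L) (toT L p) ↔ ZIsFace i c₀ p := by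
  have hT : Touches i (toT L p) ↔ ZTouches i p := Iff.rfl
  unfold IsFace ZIsFace
  rw [hT]
  unfold ZIsUpper at hp
  have hx : c₀ ≤ p.1 i ∧ p.1 i < c₀ + L := by rcases hp with h | h <;> constructor <;> omega
  have hh := ht_toT L i c₀ p.1 hx.1 hx.2
  change ((ht i (c₀ : ZMod L) (toT L p).1 : ℕ) : ℤ) = p.1 i - c₀ at hh
  constructor
  · rintro ⟨h1, h2⟩; exact ⟨h1, by omega⟩
  · rintro ⟨h1, h2⟩; exact ⟨h1, by omega⟩

variable {N : ℕ} {G : Type*} [Group G] [TopologicalSpace G] [IsTopologicalGroup G] [CompactSpace G]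
  [MeasurableSpace G] [BorelSpace G] [SecondCountableTopology G]
variable (ρ : G →* Matrix (Fin N) (Fin N) ℂ) (β : ℝ)

/-- The free-boundary partition function `Z(A) = ∫ ∏_{p ∈ A} exp(-β (N - Re tr ρ(U_p))) dg_∞` of a finite
set of plaquettes of `ℤ^d` (the tree's `ℨ⟦β, A⟧`). -/
def zdZ (A : Finset (ZdPlaquette d)) : ℝ :=
  ∫ U, ∏ p ∈ A, Real.exp (-β * ((N : ℝ) - plaquetteObs ρ p.1 p.2.1.1 p.2.1.2 U)) ∂zdHaar d G

omit [SecondCountableTopology G] in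
theorem zdZ_nonneg (A : Finset (ZdPlaquette d)) : 0 ≤ zdZ ρ β A :=
  integral_nonneg fun _ => prod_nonneg fun _ _ => (Real.exp_pos _).le

/-- **The doubling inequality on `ℤ^d`**: for a finite set `I` of upper plaquettes of range `H` above the
hyperplane `x_i = c₀` (placed inside `[0, L-2]^d` together with its double, `2H < L`),
`Z(I)² ≤ Z(I ∪ θ(I ∖ faces))`. -/
theorem zdZ_sq_le_zdZ_zDouble (hρ : Continuous ρ) (hρN : ∀ g, (ρ g).trace.re ≤ N) (hβ : 0 ≤ β)
    (i : Fin d) (c₀ : ℤ) {H L : ℕ} [NeZero L] (hH : 2 * H < L) {I : Finset (ZdPlaquette d)}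
    (hup : ∀ p ∈ I, ZIsUpper i c₀ H p) (hI : ∀ p ∈ I, ∀ k, 0 ≤ p.1 k ∧ p.1 k + 2 ≤ L)
    (hD : ∀ p ∈ zDouble i c₀ I, ∀ k, 0 ≤ p.1 k ∧ p.1 k + 2 ≤ L) :
    zdZ ρ β I ^ 2 ≤ zdZ ρ β (zDouble i c₀ I) := by
  have hHL : H < L := by omega
  have hA : ∀ q ∈ I.image (toT L), IsUpper i (c₀ : ZMod L) H q := by
    intro q hq
    obtain ⟨p, hp, rfl⟩ := mem_image.1 hq
    exact isUpper_toT hHL (hup p hp)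
  have key := sq_integral_prod_tw_le ρ β hρ hρN hβ hH hA
  have hset : I.image (toT L) ∪ ((I.image (toT L)).filter fun q => ¬ IsFace i (c₀ : ZMod L) q).image
      (plaqReflect i (c₀ : ZMod L)) = (zDouble i c₀ I).image (toT L) := by
    rw [zDouble, image_union, Finset.filter_image, image_image, image_image]
    congr 1
    have hf : (I.filter fun p => ¬ IsFace i (c₀ : ZMod L) (toT L p)) = I.filter fun p => ¬ ZIsFace i c₀ p :=
      filter_congr fun p hp => by rw [isFace_toT_iff hHL (hup p hp)]
    rw [hf]
    exact image_congr fun p _ => by simp [Function.comp, toT_zPlaqReflect]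
  rw [hset] at key
  have e1 : (∫ U, ∏ p ∈ I.image (toT L), tw ρ β p U ∂(Measure.pi fun _ : Edge d L => haarProbability G)) =
      zdZ ρ β I := FreeEnergy.integral_torusWeight_image ρ hρ β hI
  have e2 : (∫ U, ∏ p ∈ (zDouble i c₀ I).image (toT L), tw ρ β p U
      ∂(Measure.pi fun _ : Edge d L => haarProbability G)) = zdZ ρ β (zDouble i c₀ I) :=
    FreeEnergy.integral_torusWeight_image ρ hρ β hD
  rw [e1, e2] at key
  exact key

end Zd

/-! ## §5 Boxes: `d` successive reflections double a cube, `Z(B_m)^(2^d) ≤ Z(B_{2m-1})` -/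

section Boxes

open scoped Classical
open Literature.Probability.LatticeModels (halfOpenBox Torus.proj)

variable {d : ℕ}

/-- `1` if the plaquette extends in direction `k`, else `0`. -/
def bump (p : ZdPlaquette d) (k : Fin d) : ℤ := if ZTouches k p then 1 else 0

theorem bump_nonneg (p : ZdPlaquette d) (k : Fin d) : 0 ≤ bump p k := by
  unfold bump; split_ifs <;> norm_num

theorem bump_le_one (p : ZdPlaquette d) (k : Fin d) : bump p k ≤ 1 := by
  unfold bump; split_ifs <;> norm_num

theorem bump_of_touches {p : ZdPlaquette d} {k : Fin d} (h : ZTouches k p) : bump p k = 1 := if_pos h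

theorem bump_of_not_touches {p : ZdPlaquette d} {k : Fin d} (h : ¬ ZTouches k p) : bump p k = 0 := if_neg h

theorem bump_eq (p : ZdPlaquette d) (k : Fin d) :
    bump p k = (if k = p.2.1.1 then 1 else 0) + (if k = p.2.1.2 then 1 else 0) := by
  have hne : p.2.1.1 ≠ p.2.1.2 := ne_of_lt p.2.2
  unfold bump ZTouches
  by_cases h1 : k = p.2.1.1 <;> by_cases h2 : k = p.2.1.2
  · exact absurd (h1.symm.trans h2) hne
  · rw [if_pos (Or.inl h1.symm), if_pos h1, if_neg h2]; norm_num
  · rw [if_pos (Or.inr h2.symm), if_neg h1, if_pos h2]; norm_num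
  · rw [if_neg (by rintro (h | h) <;> [exact h1 h.symm; exact h2 h.symm]), if_neg h1, if_neg h2]; norm_num

/-- `(zPlaqReflect p).2 = p.2`, so bumps are unchanged. -/
theorem bump_zPlaqReflect (i : Fin d) (c₀ : ℤ) (p : ZdPlaquette d) (k : Fin d) :
    bump (zPlaqReflect i c₀ p) k = bump p k := rfl

theorem zPlaqReflect_fst_self_of_touches {i : Fin d} (c₀ : ℤ) {p : ZdPlaquette d} (h : ZTouches i p) :
    (zPlaqReflect i c₀ p).1 i = c₀ + c₀ - p.1 i - 1 := by
  simp [zPlaqReflect, h, zReflect]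

theorem zPlaqReflect_fst_self_of_not {i : Fin d} (c₀ : ℤ) {p : ZdPlaquette d} (h : ¬ ZTouches i p) :
    (zPlaqReflect i c₀ p).1 i = c₀ + c₀ - p.1 i := by
  simp [zPlaqReflect, h, zReflect]

theorem zPlaqReflect_fst_ne (i : Fin d) (c₀ : ℤ) (p : ZdPlaquette d) {k : Fin d} (hk : k ≠ i) :
    (zPlaqReflect i c₀ p).1 k = p.1 k := by
  unfold zPlaqReflect
  split_ifs <;> simp [zReflect, hk]

theorem zReflect_zReflect (i : Fin d) (c₀ : ℤ) (x : Fin d → ℤ) : zReflect i c₀ (zReflect i c₀ x) = x := by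
  ext k
  by_cases hk : k = i
  · subst hk; simp [zReflect]
  · simp [zReflect, hk]

theorem zReflect_sub_single (i : Fin d) (c₀ : ℤ) (x : Fin d → ℤ) :
    zReflect i c₀ (x - Pi.single i 1) = zReflect i c₀ x + Pi.single i 1 := by
  ext k
  by_cases hk : k = i
  · subst hk; simp [zReflect]; ring
  · simp [zReflect, hk]

theorem zPlaqReflect_zPlaqReflect (i : Fin d) (c₀ : ℤ) (p : ZdPlaquette d) :
    zPlaqReflect i c₀ (zPlaqReflect i c₀ p) = p := by
  obtain ⟨x, jk⟩ := p
  unfold zPlaqReflect ZTouches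
  by_cases h : jk.1.1 = i ∨ jk.1.2 = i
  · simp only [h, if_true, zReflect_sub_single, zReflect_zReflect, add_sub_cancel_right]
  · simp only [h, if_false, zReflect_zReflect]

/-- The plaquettes of the closed lattice box `∏_k [lo_k, hi_k]` (all four corners inside). -/
def boxPlaqs (lo hi : Fin d → ℤ) : Finset (ZdPlaquette d) :=
  ((Fintype.piFinset fun k => Finset.Icc (lo k) (hi k)) ×ˢ Finset.univ).filter fun p => ∀ k, p.1 k + bump p k ≤ hi k

theorem mem_boxPlaqs {lo hi : Fin d → ℤ} {p : ZdPlaquette d} :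
    p ∈ boxPlaqs lo hi ↔ ∀ k, lo k ≤ p.1 k ∧ p.1 k + bump p k ≤ hi k := by
  unfold boxPlaqs
  rw [mem_filter, mem_product, Fintype.mem_piFinset]
  simp only [mem_Icc, mem_univ, and_true]
  constructor
  · rintro ⟨h1, h2⟩ k; exact ⟨(h1 k).1, h2 k⟩
  · intro h
    refine ⟨fun k => ⟨(h k).1, ?_⟩, fun k => (h k).2⟩
    have := (h k).2; have := bump_nonneg p k; omega

/-- Chatterjee's cube `cubePlaqs d n` (plaquettes with all corners in `[0,n)^d`) in coordinates. -/
theorem mem_cubePlaqs_iff (n : ℕ) (p : ZdPlaquette d) :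
    p ∈ ChatterjeeFreeEnergy.cubePlaqs d n ↔ ∀ k, 0 ≤ p.1 k ∧ p.1 k + bump p k + 1 ≤ n := by
  have hne : p.2.1.1 ≠ p.2.1.2 := ne_of_lt p.2.2
  unfold ChatterjeeFreeEnergy.cubePlaqs
  rw [mem_filter, FreeEnergy.mem_boxPlaqs, Plaq.mem_plaquettesIn]
  simp only [Plaq.ofZd, Literature.Probability.LatticeModels.mem_halfOpenBox, Pi.add_apply, Pi.single_apply,
    bump_eq]
  constructor
  · rintro ⟨h0, -, -, -, -, h3⟩ k
    have a0 := h0 k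
    have a3 := h3 k
    refine ⟨a0.1, ?_⟩
    by_cases e1 : k = p.2.1.1 <;> by_cases e2 : k = p.2.1.2 <;>
      simp only [e1, e2, hne, hne.symm, if_true, if_false] at a3 ⊢ <;> omega
  · intro h
    refine ⟨fun k => ⟨(h k).1, ?_⟩, fun k => ⟨(h k).1, ?_⟩, p.2.2, fun k => ?_, fun k => ?_, fun k => ?_⟩ <;>
    · have a := h k
      by_cases e1 : k = p.2.1.1 <;> by_cases e2 : k = p.2.1.2 <;>
        simp only [e1, e2, hne, hne.symm, if_true, if_false] at a ⊢ <;> omega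

theorem cubePlaqs_eq_boxPlaqs (n : ℕ) :
    ChatterjeeFreeEnergy.cubePlaqs d n = boxPlaqs (fun _ => (0 : ℤ)) (fun _ => (n : ℤ) - 1) := by
  ext p
  rw [mem_cubePlaqs_iff, mem_boxPlaqs]
  exact forall_congr' fun k => by constructor <;> rintro ⟨h1, h2⟩ <;> exact ⟨h1, by omega⟩

/-- Translating a box of plaquettes. -/
theorem boxPlaqs_image_shift (lo hi v : Fin d → ℤ) :
    (boxPlaqs lo hi).image (fun p : ZdPlaquette d => (p.1 + v, p.2)) = boxPlaqs (lo + v) (hi + v) := by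
  ext q
  constructor
  · intro hq
    obtain ⟨p, hp, rfl⟩ := mem_image.1 hq
    rw [mem_boxPlaqs] at hp ⊢
    intro k
    have := hp k
    have hb : bump ((p.1 + v, p.2) : ZdPlaquette d) k = bump p k := rfl
    simp only [Pi.add_apply, hb]
    omega
  · intro hq
    rw [mem_boxPlaqs] at hq
    refine mem_image.2 ⟨(q.1 - v, q.2), ?_, ?_⟩
    · rw [mem_boxPlaqs]
      intro k
      have := hq k
      have hb : bump ((q.1 - v, q.2) : ZdPlaquette d) k = bump q k := rfl
      simp only [Pi.sub_apply, Pi.add_apply, hb] at this ⊢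
      omega
    · simp

/-- **Reflecting a box in its bottom face doubles it**:
`B ∪ θ(B ∖ face) = ` the box with `lo_i` replaced by `2 lo_i - hi_i`. -/
theorem zDouble_boxPlaqs (lo hi : Fin d → ℤ) (i : Fin d) (hi_ : lo i ≤ hi i) :
    zDouble i (lo i) (boxPlaqs lo hi) = boxPlaqs (Function.update lo i (2 * lo i - hi i)) hi := by
  ext q
  rw [zDouble, mem_union, mem_image]
  constructor
  · rintro (hq | ⟨p, hp, rfl⟩)
    · rw [mem_boxPlaqs] at hq ⊢
      intro k
      have := hq k
      by_cases hk : k = i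
      · subst hk; rw [Function.update_self]; omega
      · rw [Function.update_of_ne hk]; exact this
    · rw [mem_filter, mem_boxPlaqs] at hp
      obtain ⟨hp, hnf⟩ := hp
      rw [mem_boxPlaqs]
      intro k
      by_cases hk : k = i
      · subst hk
        rw [Function.update_self, bump_zPlaqReflect]
        have hpk := hp k
        by_cases ht : ZTouches k p
        · rw [zPlaqReflect_fst_self_of_touches (lo k) ht]
          rw [bump_of_touches ht] at hpk ⊢
          omega
        · rw [zPlaqReflect_fst_self_of_not (lo k) ht]
          rw [bump_of_not_touches ht] at hpk ⊢
          have hne : p.1 k ≠ lo k := fun h => hnf ⟨ht, h⟩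
          omega
      · rw [Function.update_of_ne hk, bump_zPlaqReflect, zPlaqReflect_fst_ne i (lo i) p hk]
        exact hp k
  · intro hq
    rw [mem_boxPlaqs] at hq
    by_cases hqi : lo i ≤ q.1 i
    · left
      rw [mem_boxPlaqs]
      intro k
      have := hq k
      by_cases hk : k = i
      · subst hk; exact ⟨hqi, this.2⟩
      · rw [Function.update_of_ne hk] at this; exact this
    · right
      push Not at hqi
      have hqi' := hq i
      rw [Function.update_self] at hqi'
      refine ⟨zPlaqReflect i (lo i) q, ?_, zPlaqReflect_zPlaqReflect i (lo i) q⟩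
      rw [mem_filter, mem_boxPlaqs]
      refine ⟨fun k => ?_, ?_⟩
      · by_cases hk : k = i
        · subst hk
          rw [bump_zPlaqReflect]
          by_cases ht : ZTouches k q
          · rw [zPlaqReflect_fst_self_of_touches (lo k) ht]
            rw [bump_of_touches ht] at hqi' ⊢
            omega
          · rw [zPlaqReflect_fst_self_of_not (lo k) ht]
            rw [bump_of_not_touches ht] at hqi' ⊢
            omega
        · have := hq k
          rw [Function.update_of_ne hk] at this
          rw [bump_zPlaqReflect, zPlaqReflect_fst_ne i (lo i) q hk]
          exact this
      · have hT : ZTouches i (zPlaqReflect i (lo i) q) ↔ ZTouches i q := Iff.rfl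
        unfold ZIsFace
        rw [hT]
        rintro ⟨hnt, hc0⟩
        rw [zPlaqReflect_fst_self_of_not (lo i) hnt] at hc0
        omega

/-- Lower corners after reflecting in the first `k` coordinate directions. -/
def loK (lo hi : Fin d → ℤ) (k : ℕ) : Fin d → ℤ := fun l => if (l : ℕ) < k then 2 * lo l - hi l else lo l

theorem loK_zero (lo hi : Fin d → ℤ) : loK lo hi 0 = lo := by
  funext l; simp [loK]

theorem loK_apply_of_eq (lo hi : Fin d → ℤ) {k : ℕ} {i : Fin d} (h : (i : ℕ) = k) : loK lo hi k i = lo i := by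
  simp [loK, h]

theorem loK_succ (lo hi : Fin d → ℤ) {k : ℕ} {i : Fin d} (h : (i : ℕ) = k) :
    Function.update (loK lo hi k) i (2 * lo i - hi i) = loK lo hi (k + 1) := by
  funext l
  by_cases hl : l = i
  · subst hl; rw [Function.update_self]; simp [loK, h]
  · rw [Function.update_of_ne hl]
    have hl' : (l : ℕ) ≠ k := fun h' => hl (Fin.ext (h'.trans h.symm))
    simp only [loK]
    by_cases h1 : (l : ℕ) < k
    · rw [if_pos h1, if_pos (by omega)]
    · rw [if_neg h1, if_neg (by omega)]

theorem loK_of_le (lo hi : Fin d → ℤ) {k : ℕ} (hk : d ≤ k) : loK lo hi k = fun l => 2 * lo l - hi l := by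
  funext l; simp [loK, show (l : ℕ) < k from by omega]

theorem loK_nonneg (lo hi : Fin d → ℤ) (hlohi : ∀ l, lo l ≤ hi l) (hpos : ∀ l, 0 ≤ 2 * lo l - hi l) (k : ℕ)
    (l : Fin d) : 0 ≤ loK lo hi k l := by
  have := hlohi l; have := hpos l
  simp only [loK]; split_ifs <;> omega

variable {N : ℕ} {G : Type*} [Group G] [TopologicalSpace G] [IsTopologicalGroup G] [CompactSpace G]
  [MeasurableSpace G] [BorelSpace G] [SecondCountableTopology G]
variable (ρ : G →* Matrix (Fin N) (Fin N) ℂ) (β : ℝ)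

/-- `k` successive reflections: `Z(box)^(2^k) ≤ Z(box reflected in directions 0, …, k-1)`. -/
theorem zdZ_boxPlaqs_pow_le (hρ : Continuous ρ) (hρN : ∀ g, (ρ g).trace.re ≤ N) (hβ : 0 ≤ β)
    (lo hi : Fin d → ℤ) (hlohi : ∀ l, lo l ≤ hi l) (hpos : ∀ l, 0 ≤ 2 * lo l - hi l)
    {L : ℕ} [NeZero L] (hL1 : ∀ l, 2 * (hi l - lo l) < L) (hL2 : ∀ l, hi l + 2 ≤ L) :
    ∀ k, k ≤ d → zdZ ρ β (boxPlaqs lo hi) ^ (2 ^ k) ≤ zdZ ρ β (boxPlaqs (loK lo hi k) hi)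
  | 0, _ => by simp [loK_zero]
  | k + 1, hk => by
      have ih := zdZ_boxPlaqs_pow_le hρ hρN hβ lo hi hlohi hpos hL1 hL2 k (by omega)
      have hkd : k < d := by omega
      obtain ⟨i, hik⟩ : ∃ i : Fin d, (i : ℕ) = k := ⟨⟨k, hkd⟩, rfl⟩
      obtain ⟨H, hHdef⟩ := Int.eq_ofNat_of_zero_le (sub_nonneg.2 (hlohi i))
      have hc : loK lo hi k i = lo i := loK_apply_of_eq lo hi hik
      have hbox : zDouble i (lo i) (boxPlaqs (loK lo hi k) hi) = boxPlaqs (loK lo hi (k + 1)) hi := by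
        have h := zDouble_boxPlaqs (loK lo hi k) hi i (by rw [hc]; exact hlohi i)
        rw [hc] at h
        rw [h, ← loK_succ lo hi hik]
      have hmem : ∀ k', ∀ p ∈ boxPlaqs (loK lo hi k') hi, ∀ l, 0 ≤ p.1 l ∧ p.1 l + 2 ≤ L := by
        intro k' p hp l
        have h1 := (mem_boxPlaqs.1 hp) l
        have h2 := loK_nonneg lo hi hlohi hpos k' l
        have h3 := bump_nonneg p l
        have h4 := hL2 l
        constructor <;> omega
      have hup : ∀ p ∈ boxPlaqs (loK lo hi k) hi, ZIsUpper i (lo i) H p := by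
        intro p hp
        have h1 := (mem_boxPlaqs.1 hp) i
        rw [hc] at h1
        unfold ZIsUpper
        by_cases ht : ZTouches i p
        · right; rw [bump_of_touches ht] at h1; exact ⟨ht, h1.1, by omega⟩
        · left; rw [bump_of_not_touches ht] at h1; exact ⟨ht, h1.1, by omega⟩
      have hHL : 2 * H < L := by have := hL1 i; omega
      have step : zdZ ρ β (boxPlaqs (loK lo hi k) hi) ^ 2 ≤ zdZ ρ β (boxPlaqs (loK lo hi (k + 1)) hi) := by
        rw [← hbox]
        exact zdZ_sq_le_zdZ_zDouble ρ β hρ hρN hβ i (lo i) hHL hup (hmem k) (by rw [hbox]; exact hmem (k + 1))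
      calc zdZ ρ β (boxPlaqs lo hi) ^ 2 ^ (k + 1) = (zdZ ρ β (boxPlaqs lo hi) ^ 2 ^ k) ^ 2 := by
            rw [pow_succ, pow_mul]
        _ ≤ zdZ ρ β (boxPlaqs (loK lo hi k) hi) ^ 2 :=
            pow_le_pow_left₀ (pow_nonneg (zdZ_nonneg ρ β _) _) ih 2
        _ ≤ _ := step

/-- **Free-cube doubling.** `Z([0,m)^d)^(2^d) ≤ Z([0,2m-1)^d)` for the free-boundary Wilson partition functions of
any compact gauge group, any `β ≥ 0`, any `m ≥ 1` (Glimm–Jaffe multiple reflections for product Haar measure). -/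
theorem zdZ_cubePlaqs_pow_le (hρ : Continuous ρ) (hρN : ∀ g, (ρ g).trace.re ≤ N) (hβ : 0 ≤ β) {m : ℕ}
    (hm : 1 ≤ m) :
    zdZ ρ β (ChatterjeeFreeEnergy.cubePlaqs d m) ^ (2 ^ d) ≤
      zdZ ρ β (ChatterjeeFreeEnergy.cubePlaqs d (2 * m - 1)) := by
  set lo : Fin d → ℤ := fun _ => (m : ℤ) - 1 with hlo
  set hi : Fin d → ℤ := fun _ => 2 * (m : ℤ) - 2 with hhi
  have hshift : (boxPlaqs (fun _ => (0 : ℤ)) (fun _ => (m : ℤ) - 1)).image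
      (fun p : ZdPlaquette d => (p.1 + lo, p.2)) = boxPlaqs lo hi := by
    rw [boxPlaqs_image_shift]
    congr 1 <;> funext l <;> simp [hlo, hhi]; ring
  have h1 : zdZ ρ β (ChatterjeeFreeEnergy.cubePlaqs d m) = zdZ ρ β (boxPlaqs lo hi) := by
    rw [cubePlaqs_eq_boxPlaqs, ← hshift]
    exact (FreeEnergy.zdZ_image_shift ρ hρ β lo _).symm
  have h2 : boxPlaqs (loK lo hi d) hi = ChatterjeeFreeEnergy.cubePlaqs d (2 * m - 1) := by
    rw [loK_of_le lo hi le_rfl, cubePlaqs_eq_boxPlaqs]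
    have hcast : ((2 * m - 1 : ℕ) : ℤ) = 2 * (m : ℤ) - 1 := by omega
    congr 1 <;> funext l <;> simp only [hlo, hhi, hcast] <;> ring
  haveI : NeZero (2 * m + 1) := ⟨by omega⟩
  have h3 := zdZ_boxPlaqs_pow_le ρ β hρ hρN hβ lo hi (fun l => by simp only [hlo, hhi]; omega)
    (fun l => by simp only [hlo, hhi]; omega) (L := 2 * m + 1)
    (fun l => by simp only [hlo, hhi]; push_cast; omega) (fun l => by simp only [hhi]; push_cast; omega) d le_rfl
  rw [h1, ← h2]
  exact h3

/-- The same in terms of the tree's `zdPartitionFunction` on half-open site boxes, `d = 4`: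
`Z(B_m)^16 ≤ Z(B_{2m-1})` — the hypothesis `FreeCubeRPDoubling` of `Lines/pressure_monotone_tm.lean` §5. -/
theorem zdPartitionFunction_halfOpenBox_pow_sixteen_le (hρ : Continuous ρ) (hρN : ∀ g, (ρ g).trace.re ≤ N)
    (hβ : 0 ≤ β) {m : ℕ} (hm : 1 ≤ m) :
    (zdPartitionFunction ρ β (halfOpenBox 4 m)).toReal ^ 16 ≤
      (zdPartitionFunction ρ β (halfOpenBox 4 (2 * m - 1))).toReal := by
  rw [ChatterjeeFreeEnergy.zdPartitionFunction_toReal_eq ρ hρ β m,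
    ChatterjeeFreeEnergy.zdPartitionFunction_toReal_eq ρ hρ β (2 * m - 1)]
  have h := zdZ_cubePlaqs_pow_le (d := 4) ρ β hρ hρN hβ hm
  norm_num at h
  exact h

end Boxes

end

end Summit.QuantumFields.YangMills.Cruxes.IR.RPDoubling

/-! ## §6 The hook: `FreeCubeRPDoublingAll` holds, so (FE) above the LOGARITHMIC floor is unconditional -/

namespace Summit.QuantumFields.YangMills.Cruxes.IR.PressureMonotoneTM

open Literature.MathematicalPhysics.QuantumFieldTheory in
/-- **Glimm–Jaffe multiple reflections for the free Wilson cubes** (Part B): `Z(B_m)^16 ≤ Z(B_{2m-1})` for every compact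
`G`, every lattice representation, every `β ≥ 0`, `m ≥ 1`. -/
theorem freeCubeRPDoublingAll_holds : FreeCubeRPDoublingAll := by
  intro G _ _ _ _ _ _ r β hβ
  haveI : SecondCountableTopology G :=
    (r.continuous.isClosedEmbedding r.injective).isEmbedding.secondCountableTopology
  have hM : ∀ g, |(r.ρ g).trace.re| ≤ (r.N : ℝ) := fun g => by
    simpa [Fintype.card_fin] using
      Literature.RepresentationTheory.CompactGroups.CompactGroup.abs_re_trace_le_card r.ρ r.continuous g
  exact fun m hm => RPDoubling.zdPartitionFunction_halfOpenBox_pow_sixteen_le r.ρ β r.continuous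
    (fun g => (abs_le.1 (hM g)).2) hβ hm

/-- **(FE) above the logarithmic floor, UNCONDITIONAL**: for every compact simple `G` and lattice representation `r`
there are `c, C ≥ 0`, `β₃ > 0` with `log Z_{Λ_{2S+1},β'} − log Z_{Λ_{2S+1},β} ≤ c (2S+1)⁴ log(β/β') + C (2S+1)⁴` for all
`β₃ ≤ β' ≤ β` and all odd tori `2S+1 ≥ ⌈log β⌉₊ + 2` (idea-4's `FreeEnergyIncrementFrom`, mirrored verbatim, at the floor
`logFloor`). -/
theorem freeEnergyIncrementFrom_logFloor_holds : FreeEnergyIncrementFrom logFloor :=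
  freeEnergyIncrementFrom_logFloor freeCubeRPDoublingAll_holds


open scoped Topology
open MeasureTheory Filter Finset
open Literature.MathematicalPhysics.QuantumFieldTheory Literature.MathematicalPhysics.QuantumLattice

/-! ## §7 Equipartition ⟺ free-energy increments (Jensen / Peierls–Bogoliubov)

`log Z_{Λ_L}(·)` is convex with derivative `−⟨S⟩_{Λ_L,·}`; the derivative-free form used here is the two-point JENSEN inequality
`(b − a)·⟨S⟩_{Λ_L,b} ≤ log Z_{Λ_L}(a) − log Z_{Λ_L}(b)` (all real `a, b`; `⟨e^{(b−a)S}⟩_b = Z(a)/Z(b)` and `log E e^X ≥ E X`).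
Consequences: UNIFORM EQUIPARTITION above a volume floor `fl` (`β·⟨S⟩_{Λ_L,β} ≤ c·L⁴` for `L ≥ fl β`, `β ≥ β₃`) and the
free-energy increment bound (FE) above `fl` are EQUIVALENT up to constants (dyadic chain one way, `a = β/2` the other).  With §6
this gives unconditional uniform equipartition above the log floor `⌈log β⌉₊ + 2`; and idea-4's floor-free residual (FE below
`log β`, D-0146 R<) is thereby the same statement as TINY-TORUS EQUIPARTITION `sup_{L ≤ log β} β⟨S⟩_{Λ_L,β}/L⁴ < ∞` — the toron
question (instrument row: `t·⟨S⟩_{Λ_L,t}/L⁴` at `L ∈ {2,3,4}`, `t ∈ {8,32,128}`, eng request 2026-08-28T04:12Z). -/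

section Equipartition

variable {d N : ℕ} {G : Type*} [Group G] [TopologicalSpace G] [IsTopologicalGroup G] [CompactSpace G]
  [MeasurableSpace G] [BorelSpace G] [SecondCountableTopology G]

/-- `Z_{Λ_L,β} = ∫ e^{−β S} dHaar^{links}` as a real number. -/
theorem toReal_partitionFunction_eq_integral (ρ : G →* Matrix (Fin N) (Fin N) ℂ) (hρ : Continuous ρ)
    {L : ℕ} [NeZero L] (β : ℝ) :
    (partitionFunction (d := d) (L := L) ρ β).toReal =
      ∫ U, Real.exp (-β * wilsonAction ρ U) ∂Measure.pi fun _ : Edge d L => haarProbability G := by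
  rw [FreeEnergy.partitionFunction_eq_ofReal_integral ρ hρ β,
    ENNReal.toReal_ofReal (integral_nonneg fun U => Finset.prod_nonneg fun _ _ => (Real.exp_pos _).le)]
  simp_rw [FreeEnergy.exp_neg_mul_wilsonAction ρ β]

theorem integral_exp_mul_wilsonAction_pos (ρ : G →* Matrix (Fin N) (Fin N) ℂ) (hρ : Continuous ρ)
    {L : ℕ} [NeZero L] (c : ℝ) :
    0 < ∫ U, Real.exp (c * wilsonAction ρ U) ∂Measure.pi fun _ : Edge d L => haarProbability G :=
  integral_exp_pos ((Real.continuous_exp.comp (continuous_const.mul (continuous_wilsonAction (ρ := ρ) hρ))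
    ).integrable_of_hasCompactSupport (HasCompactSupport.of_compactSpace _))

/-- `⟨e^{c S}⟩_{Λ_L,b} = Z(b − c)/Z(b)` … stated for `c = b − a`: `⟨e^{(b−a)S}⟩_b = Z(a)/Z(b)`. -/
theorem wilsonExpectation_exp_mul_wilsonAction (ρ : G →* Matrix (Fin N) (Fin N) ℂ) (hρ : Continuous ρ)
    {L : ℕ} [NeZero L] (a b : ℝ) :
    wilsonExpectation (d := d) (L := L) ρ b (fun U => Real.exp ((b - a) * wilsonAction ρ U)) =
      (∫ U, Real.exp (-a * wilsonAction ρ U) ∂Measure.pi fun _ : Edge d L => haarProbability G) /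
        ∫ U, Real.exp (-b * wilsonAction ρ U) ∂Measure.pi fun _ : Edge d L => haarProbability G := by
  have hw : Measurable fun U : GaugeConfig d L G => ENNReal.ofReal (Real.exp (-b * wilsonAction ρ U)) :=
    (Real.measurable_exp.comp ((measurable_wilsonAction ρ hρ).const_mul _)).ennreal_ofReal
  simp only [wilsonExpectation, wilsonMeasure, integral_smul_measure, wilsonWeight]
  rw [integral_withDensity_eq_integral_toReal_smul hw (ae_of_all _ fun _ => ENNReal.ofReal_lt_top)]
  have h1 : (fun U : GaugeConfig d L G => (ENNReal.ofReal (Real.exp (-b * wilsonAction ρ U))).toReal •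
      Real.exp ((b - a) * wilsonAction ρ U)) = fun U => Real.exp (-a * wilsonAction ρ U) := by
    funext U
    rw [ENNReal.toReal_ofReal (Real.exp_pos _).le, smul_eq_mul, ← Real.exp_add]
    congr 1; ring
  rw [h1, ENNReal.toReal_inv, toReal_partitionFunction_eq_integral ρ hρ b, smul_eq_mul, div_eq_inv_mul]

/-- **Jensen / Peierls–Bogoliubov for the Wilson torus pressure**: `(b − a)·⟨S⟩_{Λ_L,b} ≤ log Z_{Λ_L}(a) − log Z_{Λ_L}(b)` for all real
`a, b` (every `d`, every compact second-countable `G`, continuous `ρ`). [folklore: convexity of the pressure] -/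
theorem sub_mul_wilsonExpectation_wilsonAction_le (ρ : G →* Matrix (Fin N) (Fin N) ℂ) (hρ : Continuous ρ)
    {L : ℕ} [NeZero L] (a b : ℝ) :
    (b - a) * wilsonExpectation (d := d) (L := L) ρ b (wilsonAction ρ) ≤
      torusLogPartition d ρ a L - torusLogPartition d ρ b L := by
  haveI : IsProbabilityMeasure (wilsonMeasure (d := d) (L := L) ρ b) := isProbabilityMeasure_wilsonMeasure ρ hρ b
  have hSc : Continuous (wilsonAction (d := d) (L := L) ρ) := continuous_wilsonAction (ρ := ρ) hρ
  have hgi : Integrable (fun U => (b - a) * wilsonAction ρ U) (wilsonMeasure (d := d) (L := L) ρ b) :=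
    (continuous_const.mul hSc).integrable_of_hasCompactSupport (HasCompactSupport.of_compactSpace _)
  have hegi : Integrable (Real.exp ∘ fun U => (b - a) * wilsonAction ρ U) (wilsonMeasure (d := d) (L := L) ρ b) :=
    (Real.continuous_exp.comp (continuous_const.mul hSc)).integrable_of_hasCompactSupport
      (HasCompactSupport.of_compactSpace _)
  have hJ := ConvexOn.map_integral_le (μ := wilsonMeasure (d := d) (L := L) ρ b)
    (f := fun U => (b - a) * wilsonAction ρ U) (g := Real.exp) (s := Set.univ) convexOn_exp
    Real.continuous_exp.continuousOn isClosed_univ (ae_of_all _ fun _ => Set.mem_univ _) hgi hegi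
  have hlhs : (∫ U, (b - a) * wilsonAction ρ U ∂wilsonMeasure (d := d) (L := L) ρ b) =
      (b - a) * wilsonExpectation (d := d) (L := L) ρ b (wilsonAction ρ) := by
    rw [integral_const_mul]; rfl
  have hE := wilsonExpectation_exp_mul_wilsonAction (d := d) ρ hρ (L := L) a b
  unfold wilsonExpectation at hE
  rw [hlhs, hE] at hJ
  have hpos := div_pos (integral_exp_mul_wilsonAction_pos (d := d) ρ hρ (L := L) (-a))
    (integral_exp_mul_wilsonAction_pos (d := d) ρ hρ (L := L) (-b))
  rw [← Real.le_log_iff_exp_le hpos, Real.log_div (integral_exp_mul_wilsonAction_pos (d := d) ρ hρ (-a)).ne'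
    (integral_exp_mul_wilsonAction_pos (d := d) ρ hρ (-b)).ne'] at hJ
  simpa only [torusLogPartition, toReal_partitionFunction_eq_integral ρ hρ] using hJ

end Equipartition

section EquipartitionFE

open scoped Classical

/-- **Uniform equipartition above the volume floor `fl`** (typed here): for every compact simple `G` and lattice representation `r`
there are `c, β₃` with `β · ⟨S⟩_{Λ_L,β} ≤ c · L⁴` for all `β ≥ β₃` and all tori `L ≥ fl β` (`S` = total Wilson action, `6L⁴`
plaquettes: energy `O(1/β)` per plaquette, uniformly in the volume above the floor). -/
def UniformEquipartitionFrom (fl : ℝ → ℕ) : Prop :=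
  ∀ (G : Type) [Group G] [TopologicalSpace G] [IsTopologicalGroup G] [CompactSpace G],
    IsCompactSimpleLieGroup G →
    letI : MeasurableSpace G := borel G
    haveI : BorelSpace G := ⟨rfl⟩
    ∀ (r : LatticeRep G), ∃ (c β₃ : ℝ), 0 < β₃ ∧
      ∀ (L : ℕ) [NeZero L] (β : ℝ), β₃ ≤ β → fl β ≤ L →
        β * wilsonExpectation (d := 4) (L := L) r.ρ β (wilsonAction r.ρ) ≤ c * (L : ℝ) ^ 4

/-- (FE) ⇒ uniform equipartition, same floor (Jensen at `a = β/2`). -/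
theorem uniformEquipartitionFrom_of_freeEnergyIncrementFrom {fl : ℝ → ℕ} (h : FreeEnergyIncrementFrom fl) :
    UniformEquipartitionFrom fl := by
  intro G _ _ _ _ hG
  letI : MeasurableSpace G := borel G
  haveI : BorelSpace G := ⟨rfl⟩
  intro r
  obtain ⟨ν₀, C, β₃, hβ₃, hF⟩ := h G hG r
  haveI : SecondCountableTopology G :=
    (r.continuous.isClosedEmbedding r.injective).isEmbedding.secondCountableTopology
  refine ⟨2 * (ν₀ * Real.log 2 + C), 2 * β₃, by linarith, fun L _ β hβ hL => ?_⟩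
  have hJ := sub_mul_wilsonExpectation_wilsonAction_le (d := 4) r.ρ r.continuous (L := L) (β / 2) β
  have hF' := hF L (β / 2) β (by linarith) (by linarith) hL
  have hβ0 : β ≠ 0 := by intro h0; rw [h0] at hβ; linarith
  have h2 : β / (β / 2) = 2 := by field_simp
  rw [h2] at hF'
  have h3 : (β - β / 2) = β / 2 := by ring
  rw [h3] at hJ
  nlinarith [hJ, hF']

/-- Uniform equipartition ⇒ (FE), same (monotone) floor: dyadic chain of Jensen steps `log Z(t) − log Z(β) ≤ (β − t)⟨S⟩_t ≤ t⟨S⟩_t`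
(`t ≤ β ≤ 2t`), `⌈log₂(β/β')⌉` steps. -/
theorem freeEnergyIncrementFrom_of_uniformEquipartitionFrom {fl : ℝ → ℕ} (hfl : ∀ s t : ℝ, s ≤ t → fl s ≤ fl t)
    (h : UniformEquipartitionFrom fl) : FreeEnergyIncrementFrom fl := by
  intro G _ _ _ _ hG
  letI : MeasurableSpace G := borel G
  haveI : BorelSpace G := ⟨rfl⟩
  intro r
  obtain ⟨c, β₃, hβ₃, hc⟩ := h G hG r
  haveI : SecondCountableTopology G :=
    (r.continuous.isClosedEmbedding r.injective).isEmbedding.secondCountableTopology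
  have hρN : ∀ g, (r.ρ g).trace.re ≤ (r.N : ℝ) := fun g => by
    have := Literature.RepresentationTheory.CompactGroups.CompactGroup.abs_re_trace_le_card r.ρ r.continuous g
    simp only [Fintype.card_fin] at this
    exact (abs_le.1 this).2
  have hS0 : ∀ (L : ℕ) [NeZero L] (t : ℝ), 0 ≤ wilsonExpectation (d := 4) (L := L) r.ρ t (wilsonAction r.ρ) := by
    intro L _ t
    unfold wilsonExpectation
    refine integral_nonneg fun U => ?_
    unfold wilsonAction
    exact Finset.sum_nonneg fun p _ => by linarith [hρN (plaquetteHolonomy U p.1 p.2.1.1 p.2.1.2)]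
  set c' := max c 0 with hc'
  have hc'0 : 0 ≤ c' := le_max_right _ _
  have step : ∀ (L : ℕ) [NeZero L] (t β : ℝ), β₃ ≤ t → t ≤ β → β ≤ 2 * t → fl β ≤ L →
      torusLogPartition 4 r.ρ t L - torusLogPartition 4 r.ρ β L ≤ c' * (L : ℝ) ^ 4 := by
    intro L _ t β ht htβ hβ2 hL
    have hJ := sub_mul_wilsonExpectation_wilsonAction_le (d := 4) r.ρ r.continuous (L := L) β t
    have hE := hc L t ht (le_trans (hfl t β htβ) hL)
    have h0 := hS0 L t
    have h1 : (β - t) * wilsonExpectation (d := 4) (L := L) r.ρ t (wilsonAction r.ρ) ≤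
        t * wilsonExpectation (d := 4) (L := L) r.ρ t (wilsonAction r.ρ) :=
      mul_le_mul_of_nonneg_right (by linarith) h0
    have hcL : c * (L : ℝ) ^ 4 ≤ c' * (L : ℝ) ^ 4 := mul_le_mul_of_nonneg_right (le_max_left _ _) (by positivity)
    linarith
  have chain : ∀ (n : ℕ) (L : ℕ) [NeZero L] (β' β : ℝ), β₃ ≤ β' → β' ≤ β → β ≤ 2 ^ n * β' → fl β ≤ L →
      torusLogPartition 4 r.ρ β' L - torusLogPartition 4 r.ρ β L ≤ n * (c' * (L : ℝ) ^ 4) := by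
    intro n
    induction n with
    | zero =>
      intro L _ β' β h3 h1 h2 hL
      have h : β = β' := le_antisymm (by simpa using h2) h1
      subst h
      simp
    | succ n ih =>
      intro L _ β' β h3 h1 h2 hL
      have hβ'0 : 0 < β' := lt_of_lt_of_le hβ₃ h3
      set t := max β' (β / 2) with ht
      have ht1 : β' ≤ t := le_max_left _ _
      have ht2 : t ≤ 2 ^ n * β' := by
        refine max_le (le_mul_of_one_le_left hβ'0.le (one_le_pow₀ (by norm_num))) ?_
        rw [pow_succ] at h2
        linarith
      have ht3 : t ≤ β := max_le h1 (by linarith)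
      have ht4 : β ≤ 2 * t := by
        rcases le_total β' (β / 2) with h | h
        · rw [ht, max_eq_right h]; linarith
        · rw [ht, max_eq_left h]; linarith
      have hflt : fl t ≤ L := le_trans (hfl t β ht3) hL
      have i1 := ih L β' t h3 ht1 ht2 hflt
      have i2 := step L t β (le_trans h3 ht1) ht3 ht4 hL
      push_cast
      linarith
  refine ⟨c' / Real.log 2, c', β₃, hβ₃, fun L _ β' β h3 h1 hL => ?_⟩
  have hβ'0 : 0 < β' := lt_of_lt_of_le hβ₃ h3
  have hlog2 : 0 < Real.log 2 := Real.log_pos one_lt_two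
  have hr1 : 1 ≤ β / β' := by rw [le_div_iff₀ hβ'0]; linarith
  set x := Real.log (β / β') / Real.log 2 with hx
  have hx0 : 0 ≤ x := div_nonneg (Real.log_nonneg hr1) hlog2.le
  have hn : (⌈x⌉₊ : ℝ) < x + 1 := Nat.ceil_lt_add_one hx0
  have hpow : β ≤ 2 ^ ⌈x⌉₊ * β' := by
    have hxl : Real.log (β / β') ≤ (⌈x⌉₊ : ℝ) * Real.log 2 := by
      have := Nat.le_ceil x
      rw [hx, div_le_iff₀ hlog2] at this
      exact this
    have h2x : β / β' ≤ (2 : ℝ) ^ ⌈x⌉₊ := by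
      calc β / β' = Real.exp (Real.log (β / β')) := (Real.exp_log (by positivity)).symm
        _ ≤ Real.exp ((⌈x⌉₊ : ℝ) * Real.log 2) := Real.exp_le_exp.2 hxl
        _ = (2 : ℝ) ^ ⌈x⌉₊ := by rw [← Real.rpow_natCast, Real.rpow_def_of_pos two_pos, mul_comm]
    rwa [div_le_iff₀ hβ'0] at h2x
  have hch := chain ⌈x⌉₊ L β' β h3 h1 hpow hL
  have hL4 : 0 ≤ c' * (L : ℝ) ^ 4 := by positivity
  have hm : (⌈x⌉₊ : ℝ) * (c' * (L : ℝ) ^ 4) ≤ (x + 1) * (c' * (L : ℝ) ^ 4) := mul_le_mul_of_nonneg_right hn.le hL4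
  have hxe : x * (c' * (L : ℝ) ^ 4) = c' / Real.log 2 * (L : ℝ) ^ 4 * Real.log (β / β') := by
    rw [hx]; ring
  linarith

/-- The two typed statements are equivalent for monotone floors (up to the constants hidden in the `∃`). -/
theorem uniformEquipartitionFrom_iff_freeEnergyIncrementFrom {fl : ℝ → ℕ} (hfl : ∀ s t : ℝ, s ≤ t → fl s ≤ fl t) :
    UniformEquipartitionFrom fl ↔ FreeEnergyIncrementFrom fl :=
  ⟨freeEnergyIncrementFrom_of_uniformEquipartitionFrom hfl, uniformEquipartitionFrom_of_freeEnergyIncrementFrom⟩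

end EquipartitionFE


/-! ## §8 The hook, continued: UNCONDITIONAL uniform equipartition above the log floor

`β·⟨S⟩_{Λ_L,β} ≤ c·L⁴` for all `β ≥ β₃` and all tori `L ≥ ⌈log β⌉₊ + 2`, every compact simple `G` and lattice representation `r`
(from §6 `freeEnergyIncrementFrom_logFloor_holds` by Jensen at `a = β/2`).  Below the log floor this is OPEN (torons) and is, by
`uniformEquipartitionFrom_iff_freeEnergyIncrementFrom`, exactly idea-4's floor-free residual. -/

theorem uniformEquipartitionFrom_logFloor_holds : UniformEquipartitionFrom logFloor :=
  uniformEquipartitionFrom_of_freeEnergyIncrementFrom freeEnergyIncrementFrom_logFloor_holds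

/-- idea-4's (FE) holds FLOOR-FREE (all tori `L ≥ 2`… as typed: `L ≥ 2` via the constant floor) iff uniform equipartition holds on
all tori — the typed form of «the residual R< is tiny-torus equipartition». -/
theorem freeEnergyIncrementFrom_two_iff : FreeEnergyIncrementFrom (fun _ => 2) ↔ UniformEquipartitionFrom (fun _ => 2) :=
  (uniformEquipartitionFrom_iff_freeEnergyIncrementFrom (fl := fun _ => 2) fun _ _ _ => le_rfl).symm


/-! ## §9 Weak equipartition on ALL tori (β-nonuniform by `log β`): the size of the floor-free residual

Jensen at `a = 0` (`Z_{Λ_L}(0) = 1`) and the β-uniform sharp floor of §3 give, with Chatterjee's `f(β) + (3 dim G/2) log β → K`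
(`freeEnergyLogCoefficient_proof`), `β·⟨S⟩_{Λ_L,β} ≤ L⁴·(c log β + C)` for ALL tori `L ≥ 2` and `β ≥ β₃` — PROVED.  The floor-free
residual (§8, `freeEnergyIncrementFrom_two_iff`) asks to remove the factor `log β` on the tori `2 ≤ L ≤ ⌈log β⌉₊ + 1` (§8 removes it
above); this is the same exponent gap as the torus excess `log Z_L − L⁴f ≍ κ_L log β` (torons, memo N20), and it is OPEN. -/

section WeakEquipartition

open scoped Topology
open MeasureTheory Filter Finset
open Literature.MathematicalPhysics.QuantumFieldTheory Literature.MathematicalPhysics.QuantumLattice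

variable {d N : ℕ} {G : Type*} [Group G] [TopologicalSpace G] [IsTopologicalGroup G] [CompactSpace G]
  [MeasurableSpace G] [BorelSpace G] [SecondCountableTopology G]

/-- `log Z_{Λ_L}(0) = 0` (Haar probability). -/
theorem torusLogPartition_zero (ρ : G →* Matrix (Fin N) (Fin N) ℂ) (hρ : Continuous ρ) {L : ℕ} [NeZero L] :
    torusLogPartition d ρ 0 L = 0 := by
  rw [torusLogPartition, toReal_partitionFunction_eq_integral ρ hρ]
  simp

/-- Jensen at `a = 0`: `β·⟨S⟩_{Λ_L,β} ≤ −log Z_{Λ_L}(β)`. -/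
theorem mul_wilsonExpectation_wilsonAction_le_neg_torusLogPartition (ρ : G →* Matrix (Fin N) (Fin N) ℂ)
    (hρ : Continuous ρ) {L : ℕ} [NeZero L] (β : ℝ) :
    β * wilsonExpectation (d := d) (L := L) ρ β (wilsonAction ρ) ≤ -torusLogPartition d ρ β L := by
  have h := sub_mul_wilsonExpectation_wilsonAction_le (d := d) ρ hρ (L := L) 0 β
  rw [torusLogPartition_zero ρ hρ, sub_zero, zero_sub] at h
  exact h

end WeakEquipartition

section WeakEquipartitionWilson

open scoped Topology Classical
open MeasureTheory Filter Finset
open Literature.MathematicalPhysics.QuantumFieldTheory Literature.MathematicalPhysics.QuantumLattice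

variable {G : Type} [Group G] [TopologicalSpace G] [IsTopologicalGroup G] [CompactSpace G]
  [MeasurableSpace G] [BorelSpace G]

/-- **Weak equipartition on all tori** from any asymptotics `f(β) + c log β → K`: eventually in `β`, for every torus `L ≥ 2`,
`β·⟨S⟩_{Λ_L,β} ≤ L⁴·(c log β + (1 − K))`. -/
theorem weak_equipartition_of_tendsto (r : LatticeRep G) {c K : ℝ}
    (hK : Tendsto (fun β : ℝ => freeEnergyDensity 4 r.ρ β + c * Real.log β) atTop (𝓝 K)) :
    ∀ᶠ β : ℝ in atTop, ∀ (L : ℕ) [NeZero L], 2 ≤ L →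
      β * wilsonExpectation (d := 4) (L := L) r.ρ β (wilsonAction r.ρ) ≤ (L : ℝ) ^ 4 * (c * Real.log β + (1 - K)) := by
  haveI : SecondCountableTopology G :=
    (r.continuous.isClosedEmbedding r.injective).isEmbedding.secondCountableTopology
  filter_upwards [uniform_floor_of_tendsto r hK one_pos] with β hβ L _ hL
  have h1 := mul_wilsonExpectation_wilsonAction_le_neg_torusLogPartition (d := 4) r.ρ r.continuous (L := L) β
  have h2 := hβ L hL
  have h3 : (L : ℝ) ^ 4 * (K - 1 - c * Real.log β) = -((L : ℝ) ^ 4 * (c * Real.log β + (1 - K))) := by ring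
  linarith

/-- **Weak equipartition, unconditional** (every compact simple `G`, every lattice representation): there are `c, C, β₃` with
`β·⟨S⟩_{Λ_L,β} ≤ L⁴·(c log β + C)` for all `β ≥ β₃` and ALL tori `L ≥ 2` (`c = 3 dim G / 2` from Chatterjee's theorem). -/
theorem weak_equipartition_holds :
    ∀ (G : Type) [Group G] [TopologicalSpace G] [IsTopologicalGroup G] [CompactSpace G],
      IsCompactSimpleLieGroup G →
      letI : MeasurableSpace G := borel G
      haveI : BorelSpace G := ⟨rfl⟩
      ∀ (r : LatticeRep G), ∃ (c C β₃ : ℝ), ∀ (β : ℝ), β₃ ≤ β → ∀ (L : ℕ) [NeZero L], 2 ≤ L →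
        β * wilsonExpectation (d := 4) (L := L) r.ρ β (wilsonAction r.ρ) ≤ (L : ℝ) ^ 4 * (c * Real.log β + C) := by
  intro G _ _ _ _ hG
  letI : MeasurableSpace G := borel G
  haveI : BorelSpace G := ⟨rfl⟩
  intro r
  obtain ⟨K, hK⟩ := Summit.QuantumFields.YangMills.Theorems.freeEnergyLogCoefficient_proof G hG r
  obtain ⟨β₃, hβ₃⟩ := Filter.eventually_atTop.1 (weak_equipartition_of_tendsto r hK)
  exact ⟨_, 1 - K, β₃, fun β hβ L _ hL => hβ₃ β hβ L hL⟩

end WeakEquipartitionWilson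

end Summit.QuantumFields.YangMills.Cruxes.IR.PressureMonotoneTM
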